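import Summits.CriticalPhenomena.Ising3DConformalLimit.Theses.SynchronousCoupling
import Literature.Probability.LatticeModels.CriticalGibbsUniqueness
import Literature.Probability.LatticeModels.PlusMinusStateGibbs
import Literature.Probability.LatticeModels.ProductMeasureTools
import Summits.CriticalPhenomena.Ising3DConformalLimit.Theorems.SynchronousCouplingDefs

/-!
# Disproof of `RotationJoining` (stmt-CriticalPhenomena-18763) — findings

Crux (route SynchronousCoupling, rank 3): for the critical n.n. Ising measure `μ_c` on `ℤ³`,
`∃ C θ > 0 ∀ n ≥ 1 ∀ m ∃ π ∈ Couplings(μ_c, μ_c) ∀ |u_i| ≤ m :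
E_π[(α·Σ_{x ∈ T⁻¹(n(u+[0,1)³))} σ¹_x − β·Σ_{x ∈ n(u+[0,1)³)} σ²_x)²] ≤ C n^(−θ)`, `T = A/3`,
`α, β` the self-normalisations by the `u = 0` cells. Seat: refuter-cdisprove-…-18763-0, cycle 1
(2026-08-17). Everything below is `lean check`ed (rc 0, no `sorry`, axioms ⊆ {propext, choice,
Quot.sound}).

## Verdict of this cycle: NO KILL of the crux as stated; ONE load-bearing hypothesis isolated and
## refuted-without-it (§6, kernel-checked; qualitative ε-form §9; the line's FDD-isotropy stub §8); two
## hypotheses shown decorative (§1, and `1 ≤ n`); one mutation shown harmless (§7: at β = 0 the body holds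
## with defect 0, Kozma's ψ formalised); picked line read twice (reshape 1 and 2): no stub false.

* READ-BACK (§0). `rotationJoining_iff : RotationJoining ↔ ∀ μ ∈ 𝒢(β_c), TI μ → RJBody μ` is
  `Iff.rfl` over named pieces (`box`, `rotCell`, `rotCell₀`, `axisCell`, `axisCell₀`, `blockSum`,
  `normaliser`, `defect`, `RJBody`). No junk: the integrand is bounded measurable, `π.fst = μ`
  forces `π` to be a probability measure, both normalisers are `> 0` for a Gibbs `μ` (finite
  energy, `measure_cylinder_pos_of_mem_isingGibbsMeasures`); the box `[−2n(m+1), 2n(m+1)]³`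
  contains every cell with `|u_i| ≤ m` (`|x_i| ≤ 5n(m+1)/3`); `A Aᵀ = 9I`, `det A = 27`.
  COMMENSURABILITY FACT (checked numerically in `geomcheck.py`, used formally only at `n = 3k`):
  `ψ(x) = ⌊Ax/3⌋` is a bijection `ℤ³ → ℤ³` within sup-distance `< 1` of `T` (Kozma's device),
  so EVERY rotated cell has exactly `n³` lattice points; for `3 ∣ n` the rotated cells are
  lattice translates of each other (`rotCell_e0_eq_map`: cell `e₀` = cell `0 + k(2,2,−1)`).
* DECORATIVE HYPOTHESES. (i) translation invariance: `rotationJoining_iff_withoutTI` (§1) —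
  `𝒢(β_c)` is a singleton (`hasUniqueGibbsMeasure_criticalBeta_holds`) and the plus state is TI;
  the crux is a statement about ONE measure. (ii) `1 ≤ n`: at `n = 0` every cell is empty, both
  normalisers are `(√0)⁻¹ = 0`, the defect is `0 ≤ C·0^(−θ) = 0` — dropping `1 ≤ n` changes
  nothing (not formalised; trivial). (iii) the window `m` with `C` uniform in `m` is equivalent,
  by weak compactness of couplings on the Cantor space and continuity of each (local, bounded)
  defect functional, to ONE coupling `π_n` per scale with `sup_{u ∈ ℤ³} defect ≤ C n^(−θ)`; by
  averaging joint shifts `(τ_{nAᵀv/3… }, τ_{nv})`, `v ∈ 3ℤ³`, one may take `π_n` jointly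
  `3ℤ³`-stationary, so only the 27 residues `u mod 3` matter (paper remark; the cards'
  `RJAvg_imp`).
* LOAD-BEARING HYPOTHESIS: the DLR/criticality membership `μ ∈ 𝒢(β_c)` (§4–§6).
  `rotationJoining_false_without_gibbs : ¬ RotationJoiningWithoutGibbs`, where
  `RotationJoiningWithoutGibbs := ∀ μ, IsProbabilityMeasure μ → TI μ → RJBody μ` (the crux with
  `μ ∈ 𝒢(β_c)` weakened to "probability measure"; `rotationJoining_of_withoutGibbs` records that
  it implies the crux). WITNESS `μL` := horizontally LAYERED i.i.d. fair spins, `σ_x = ε_{x₂}`.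
  MECHANISM (`defect_pair_lower_bound`): under ANY coupling `π` of `μL` with itself, copy 2's axis
  blocks `u = 0` and `u = e₀` are literally equal (same layers), while copy 1's rotated blocks
  `0` and `e₀` have layer profiles that are shifts of each other by `n/3` out of a support of
  length `5n/3`, hence differ in `L²(μL)` by `≥ 1/25` of the normalisation (discrete Poincaré /
  telescoping inequality `sum_sq_le_sq_mul_sum_sq_sub_shift`, §3; numerically the ratio is
  `0.515` for `e₀` and `1.419` for `e₁, e₂`, all `n ≤ 24`); so `max(defect₀, defect_{e₀}) ≥ 1/150`
  at every scale `n = 3k`, contradicting `C n^(−θ) → 0`. MORAL for provers: the obstruction is an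
  EXACT DEGENERACY of the axis block field not shared by the rotated block field — any proof must
  feed in (asymptotic) ISOTROPY of the block-spin law of `μ_c`, quantitatively; DLR for SOME
  finite-range ferromagnet is not enough either (paper: the anisotropic n.n. model `J_z ≠ J_xy` at
  its own critical point has an anisotropic conformal limit, rotated and axis unit-cube block
  spins then differ in law at `O(1)`, and the same triangle argument with `u, v` far apart kills
  every coupling) — so what is really load-bearing is `B₃`-symmetry + emergent `O(3)`.
* A NECESSARY CONDITION the provers can test (paper, same triangle argument as §5 with general
  blocks `u, v`): `RJBody μ` ⇒ `| ‖X_u − X_v‖_{L²(μ)} − ‖Y_u − Y_v‖_{L²(μ)} | ≤ 2√(C n^(−θ))` for all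
  `u, v` (uniformly!), `X` = normalised rotated blocks, `Y` = normalised axis blocks of ONE copy:
  power-rate isotropy of the block-spin variogram. For `μ_c` this is the expected corrections-to-
  scaling statement (rate `n^(−ω)`, `ω ≈ 0.83`, or `n^(−ω_NR)`, `ω_NR ≈ 2.02`, for the genuinely
  anisotropic part; normaliser mismatch `E S₁(0)²/E S₂(0)² − 1 = O(n^(−1))` from cell shape) —
  consistent with the crux for small `θ`; the lattice-GFF anchor of TOY-RESULTS.md gives
  `θ_Gauss ≈ 3.7`. Hence NO cheap kill: a refutation of the crux itself needs a theorem that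
  `μ_c` admits no power-rate joining although all finite-dimensional block statistics converge
  with power rates — an IR noise-sensitivity / non-`d̄`-continuity statement for the critical
  field, far beyond the tree (and a RATE-FREE version is plausibly true: the attractive Ising
  plus state is finitely determined / Bernoulli as a `ℤ^d`-action — Ornstein–Weiss for `ℤ²`,
  Adams 1992, doi:10.1017/s0143385700006994, "Følner independent ⇒ finitely determined ⇒
  Bernoulli" — so `d̄`-type joinings with `o(1)` defect are expected once fidi isotropy holds;
  only the RATE is in doubt, exactly as the route's why-might-fail line says).
* NUMERICS (kit job j026075, evidence `compute-j026075.json`; script `mcjob/main.py` in the seat folder):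
  critical 3D Ising, Swendsen–Wang on the torus `L = 14n`, `β_c = 0.221654626`, block scales
  `n = 3, 6, 9, 12` (4000/2500/1500/700 sweeps), all translates via FFT; sanity: i.i.d. `D = 2.00`,
  layered `μL`: `D_Y(e₀) = 0.0000`, `D_X(e₀) = 0.50/0.54` (exact `0.5153/0.5147`). With
  `D_X(v) = E(X_0 − X_v)²` (rotated cells), `D_Y(v)` (axis cells), normalised as in the crux:
  normaliser mismatch `E S_rot²/E S_ax² − 1 = −0.0393(1), −0.0129(1), −0.0063(1), −0.0035(0)`
  (`∝ n^(−1.8)`); anisotropy `D_X − D_Y` at `v = e₀+e₁+e₂`: `−0.03614(9), −0.01122(6), −0.00519(4),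
  −0.00301(3)` (`∝ n^(−1.8±0.1)`, local exponents 1.69, 1.90, 1.89); at `v = e₀`: `−0.0299(4),
  −0.0129(7), −0.0044(7), −0.0021(14)`; Binder-ratio difference rot−axis `+0.0013, −0.0045, −0.0027,
  −0.0018`. The rigorous two-point lower bound on ANY coupling's defect,
  `LB(v) = (√D_X − √D_Y)²/4 ≤ max(defect₀, defect_v)`, is `6·10⁻⁵, 1·10⁻⁵, ≲4·10⁻⁶, ≲2·10⁻⁶`
  (`∝ n^(−3.6)`, noise-limited at `n = 12`). READING: every statistic of order ≤ 4 of the normalised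
  block field is isotropic up to a clean POWER `n^(−1.8(1))` — consistent with the cubic-anisotropy
  correction exponent `ω_NR ≈ 2.02` and with `O(n^(−2))` cell-shape effects — so nothing computable at
  this level obstructs `RotationJoining` for `θ ≤ 3.6`; the crux resists all cheap attacks and its open
  content is the EXISTENCE of couplings realising these rates jointly over windows (the `d̄`-type step).
* DEAD ENDS (one line each). Norm attack (`‖X_u‖ ≠ ‖Y_u‖`): dead, every cell has `n³` points and
  shape effects are `O(1/n)`. Degenerate TI measures (`δ₊`, `½(δ₊+δ₋)`, periodic mixtures): satisfy
  the Gibbs-free body (block spins self-average). β = 0 (i.i.d.): satisfies it with defect `0`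
  (relabel copy 2 by `ψ`; i.i.d. is `ψ`-invariant) — so "high temperature" is not an obstruction,
  the content is the power RATE at `β_c`. Junk values (`(√0)⁻¹ = 0`): unreachable for Gibbs `μ`.
* ROUTE-LEVEL (from Cruxes/RotationJoining/SKELVET.md, confirmed): the only consumer of RJ is
  `JoiningsTransfer`'s (ROT), already a theorem (`LimitRotationInvariant_of HRP2Rigidity_of`);
  RJ is dead weight for `closes` in substance.

* MUTATION `β_c ↦ 0` (§7, kernel-checked): `rjBody_iid : RJBody μ₀` for i.i.d. fair spins `μ₀` —
  the body of the crux holds with defect ZERO at every `n, m, u` via the deterministic relabelling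
  coupling `π = law of (σ, σ ∘ ψ⁻¹)`, where `ψ = ⌊A·/3⌋` is Kozma's commensurate-rotation
  BIJECTION of `ℤ³` (`psiEquiv`, `psi_psiInv`, `psiInv_psi`, `|3ψ(x) − Ax|_∞ ≤ 2`:
  `abs_three_mul_psi_sub_le`), every rotated cell being the `ψ⁻¹`-image of its axis cell
  (`rotCell_eq_map_psiInv`, hence `card_rotCell : #rotCell = n³`). So the value of `β` is not
  load-bearing in the falsity direction; this formal `ψ` is reusable infrastructure for any
  lattice-level transfer (`RotBoxTransfer`/`HSSyncRotBox`): a rotated-cell reading of copy 1 IS an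
  axis-cell reading of the relabelled configuration `σ ∘ ψ⁻¹`, whose law is the push-forward
  `ψ_* μ_c` — the crux is exactly a power-rate joining of `μ_c` with `ψ_* μ_c` along axis blocks.

* PICKED LINE `SketchIdeator2` (card rate-from-dilations-splitting; lead's skeleton
  `Cruxes/RotationJoining/Lines/SketchIdeator2.lean`, vocabulary `Theorems/SynchronousCouplingDefs.lean`):
  open stubs `stub_dilationJoiningsAxis3` (⇐ item 18762), `stub_dilationJoiningsTilted`,
  `stub_asymptoticFDDIsotropy`; transfers LANDED. Read for cheap falsity: all three correctly typed, none
  vacuous, no junk (normalisers/boxes consistent; `j = 0` window trivial; `n → ∞` only). §8 (kernel-checked):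
  `asymptoticFDDIsotropy_false_without_gibbs` — the FDD-isotropy stub with `μ ∈ 𝒢(β_c)` weakened to "TI
  probability measure" is FALSE (same witness `μL`, window `(0,e₀)`, test `min(|v₀−v₁|,1)/2`; Khintchine
  `E(Σc_jε_j)⁴ ≤ 3(Σc_j²)²` by induction on the support + truncation `min(|x|,1) ≥ τx² − τ²x⁴/4`, giving
  `E_μL f(X) ≥ 97/5000` vs `E_μL f(Y) = 0`). Heuristically (paper) `μL` SATISFIES both dilation-joining stubs
  (Brownian scaling of layer partial sums + KMT, rate `b^(−1+o(1))`), so within the line the isotropy stub 3a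
  carries the whole load — consistent with the card's thesis "the rate is free, the rotation is an identity of
  limit laws". In the line's own vocabulary: `tiltCell = rotCell`, `RateSplitting.blockSum = blockSum`,
  `normTilt μ n m = normaliser μ (rotCell n m 0)`, `normAxis μ n = normaliser μ (axisCell n 0)` hold by `rfl`
  (same terms), and `rotCell n m 0 = rotCell₀ n m` (`rotCell_zero`) — done in §9 / modules 7–8.
  RESHAPE 2 (lead c1-0, `Theorems/SynchronousCouplingRotationJoiningIsotropyDefs.lean`, 2026-08-17 ~14–15:30Z):
  stubs `routeCruxes` (= items 18762 ∧ 4658 verbatim, not worked), `twoPointToolkit` (DJ → UR → toolkit),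
  `tiltGeometry`, `tiltedTransfer`, `momentsToTests`, `newmanBlocks` — ALL FIVE LANDED by the lead (tree files
  `…TwoPointToolkit/TiltGeometry/TiltedTransfer/MomentsToTests/NewmanBlocks.lean`) — and the lead's own
  `isotropyTransfer` (toolkit → geometry → BallSums → Newman → moments → DJ → UR → AsymptoticFDDIsotropy; in
  progress: `Isotropy{Limit,Moments,FourPoint,NearField,FarField,NearGeneric,…}.lean`). Cheap-falsity pass on the
  statements BEFORE noticing they were landed (kept as independent confirmation): `TiltGeometry` (7) `[s,2s)³ ⊆
  tilted cell 0` (`2s+1 ≤ (Ax)_i ≤ 7s−4 < 3L`), (8) decomposition constants (remainder ≤ `6·b²(5b'+2)/3 ≤ 14 b²b' ≤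
  30 b²b'`, resp. `≤ 18b²(15b'+2) ≤ 306 b²b' ≤ 810 b²b'`; `I = ∅` suffices when `b ≤ 30b'`), (9) `|x_i − y_i| ≤
  (5/9)·3n < 2n` — all true; `NewmanBlocks` true (𝒢(β_c) singleton = plus state; Newman 1975 / ADC 2021 §6.3 with
  coincidences); `MomentsToTests` true (tightness from 2nd moments, `E X^{2k} ≤ (Kk)^k` ⇒ exponential moments ⇒
  determinacy ⇒ equal subsequential limits). JOINT SUFFICIENCY: `RotationJoining_of` closes the crux MODULO
  `RouteCruxes = DilationJoinings ∧ UniformRegularity` through genuine implications — no vacuous hypothesis is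
  smuggled (every analytic input is derived from DJ ∧ UR or is a landed fact); so the crux carries no content
  independent of items 18762/4658 + the tree's `LimitRotationInvariant_of` (item 1980, where rotational symmetry
  enters). No `stub_false`. LOAD-BEARING INPUT OF THE LINE, formal: `IsProbabilityMeasure μ` in place of
  `μ ∈ 𝒢(β_c)` falsifies `AsymptoticFDDIsotropy` (§8, module 6) and even `QualitativeRotationJoining` (§9,
  module 7: `ε = 1/151`), i.e. the Gibbs/rotation input must enter exactly at `isotropyTransfer`.

## Landed / proposed (Negative lane, `--supports stmt-CriticalPhenomena-18763`)
`Theorems/RotationJoining/Negative/{Defs (p160863), ShiftInequality (p160909), Geometry (p161797),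
LayeredMeasure (p162011), RotationJoiningFalseWithoutGibbs (p166676: §5–§6, `rotationJoining_false_without_gibbs`,
`rotationJoining_iff_withoutTI`), FDDIsotropyFalseWithoutGibbs (p169180: §8, module 6), LineFormWithoutGibbs
(p169272: §9, module 7), FDDIsotropyLineForm (p169439: module 8, §8 in the line's vocabulary +
`asymptoticFDDIsotropy_iff_lane`)}.lean` — ALL ACCEPTED (importable as
`Summits.CriticalPhenomena.Ising3DConformalLimit.Theorems.RotationJoining.Negative.<Module>`).
`PsiBijection.lean` (§7) NOT landed: the lead adopted `psi/psiInv/card` into `…TiltGeometry.lean` (dedup) — import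
that file instead. Numerics: job j026075 (evidence `compute-j026075.json`, `numerics-j026075-summary.txt`).

## Index
§0 named pieces + `rotationJoining_iff` · §1 `rotationJoining_iff_withoutTI` · §2 Σ3 lattice
geometry (`omega`) · §3 telescoping inequality · §4 `μL` (coin, `P = infinitePi`, `layer`,
translation invariance, moments, layer profiles, `V0 ≥ 1`, `V0 ≤ 25·V1`) · §5 the coupling
argument (`integral_HK_sq`, `integral_FG_sq`, `defect_pair_lower_bound`, `not_RJBody_μL`) ·
§6 `RotationJoiningWithoutGibbs`, `rotationJoining_false_without_gibbs` · §7 `ψ` bijection,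
`card_rotCell`, `μ₀`, `rjBody_iid` · §8 Khintchine-4, truncation, `Dk`, `ftest`,
`asymptoticFDDIsotropy_false_without_gibbs` · §9 line vocabulary bridges (`tiltCell_eq_rotCell`, `lineDefect_eq`,
`qualitativeRotationJoining_iff_defect`, `asymptoticFDDIsotropy_iff_lane`),
`qualitativeRotationJoining_false_without_gibbs`.
-/

namespace Summit.CriticalPhenomena.Ising3DConformalLimit.Cruxes.RotationJoining.Disproof

open MeasureTheory Filter Finset
open Literature.Probability.LatticeModels
open Summit.CriticalPhenomena.Ising3DConformalLimit.Theses.SynchronousCoupling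

noncomputable section

/-! ## §0 The crux, re-read through named pieces -/

/-- The integer matrix `A = 3T` of the crux (`A Aᵀ = 9·I`, `det A = 27`). -/
def A : Matrix (Fin 3) (Fin 3) ℤ := !![(2:ℤ), 2, -1; -1, 2, 2; 2, -1, 2]

/-- The bounding box `[-2n(m+1), 2n(m+1)]³` in which copy 1 is read. -/
def box (n m : ℕ) : Finset (Site 3) :=
  Fintype.piFinset (fun _ : Fin 3 => Finset.Icc (-(2 * ((n:ℤ)) * ((m:ℤ) + 1))) (2 * ((n:ℤ)) * ((m:ℤ) + 1)))

/-- The rotated cell of index `u` at scale `n`: lattice points `x` of the box with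
`A x ∈ 3n(u + [0,1)³)`, i.e. `x ∈ T⁻¹(n(u+[0,1)³))`. -/
def rotCell (n m : ℕ) (u : Fin 3 → ℤ) : Finset (Site 3) :=
  (box n m).filter (fun x => ∀ i, 3 * ((n:ℤ)) * u i ≤ Matrix.mulVec A x i ∧
    Matrix.mulVec A x i < 3 * ((n:ℤ)) * (u i + 1))

/-- The reference rotated cell (`u = 0`) exactly as the crux writes the normaliser of copy 1. -/
def rotCell₀ (n m : ℕ) : Finset (Site 3) :=
  (box n m).filter (fun x => ∀ i, 0 ≤ Matrix.mulVec A x i ∧ Matrix.mulVec A x i < 3 * ((n:ℤ)))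

/-- The axis cell `n(u + [0,1)³) ∩ ℤ³` of copy 2. -/
def axisCell (n : ℕ) (u : Fin 3 → ℤ) : Finset (Site 3) :=
  Fintype.piFinset (fun i : Fin 3 => Finset.Ico ((n:ℤ) * u i) ((n:ℤ) * u i + (n:ℤ)))

/-- The reference axis cell `[0,n)³` (normaliser of copy 2). -/
def axisCell₀ (n : ℕ) : Finset (Site 3) :=
  Fintype.piFinset (fun _ : Fin 3 => Finset.Ico (0:ℤ) ((n:ℤ)))

/-- Block spin sum `Σ_{x ∈ s} σ_x`. -/
def blockSum (s : Finset (Site 3)) (σ : SpinConfig (Site 3)) : ℝ := ∑ x ∈ s, spinAt x σ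

/-- The self-normalisation `(E_μ[(Σ_{x∈s} σ_x)²])^{-1/2}` (junk `0` if the second moment vanishes). -/
def normaliser (μ : Measure (SpinConfig (Site 3))) (s : Finset (Site 3)) : ℝ :=
  (Real.sqrt (∫ σ, (blockSum s σ) ^ 2 ∂μ))⁻¹

/-- The `L²(π)` defect of block `u` at scale `n`, window `m`, under the coupling `π`. -/
def defect (μ : Measure (SpinConfig (Site 3))) (n m : ℕ) (u : Fin 3 → ℤ)
    (π : Measure (SpinConfig (Site 3) × SpinConfig (Site 3))) : ℝ :=
  ∫ q, (normaliser μ (rotCell₀ n m) * blockSum (rotCell n m u) q.1 -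
    normaliser μ (axisCell₀ n) * blockSum (axisCell n u) q.2) ^ 2 ∂π

/-- The body of the crux for a given measure `μ`: power-rate rotation joinings of `μ` with itself. -/
def RJBody (μ : Measure (SpinConfig (Site 3))) : Prop :=
  ∃ C θ : ℝ, 0 < θ ∧ ∀ n m : ℕ, 1 ≤ n →
    ∃ π : Measure (SpinConfig (Site 3) × SpinConfig (Site 3)), π.fst = μ ∧ π.snd = μ ∧
      ∀ u : Fin 3 → ℤ, (∀ i, |u i| ≤ m) → defect μ n m u π ≤ C * (n : ℝ) ^ (-θ)

/-- READ-BACK: the crux is literally `∀ μ ∈ 𝒢(β_c), μ translation invariant → RJBody μ`. -/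
theorem rotationJoining_iff :
    RotationJoining ↔ ∀ μ ∈ isingGibbsMeasures 3 (criticalBeta 3) 0,
      IsTranslationInvariantMeasure μ → RJBody μ := Iff.rfl

/-! ## §1 Decorative hypotheses -/

/-- The crux with the translation-invariance hypothesis DROPPED. -/
def RotationJoiningWithoutTI : Prop := ∀ μ ∈ isingGibbsMeasures 3 (criticalBeta 3) 0, RJBody μ

/-- Translation invariance is decorative: at `β_c` in `d = 3` the Gibbs measure is unique
(`hasUniqueGibbsMeasure_criticalBeta_holds`, ADS 2015) and the plus state is translation invariant
(`exists_plusMeasure_holds`), so the crux is a statement about ONE measure. -/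
theorem rotationJoining_iff_withoutTI : RotationJoining ↔ RotationJoiningWithoutTI := by
  rw [rotationJoining_iff]
  refine ⟨fun h μ hμ => ?_, fun h μ hμ _ => h μ hμ⟩
  obtain ⟨hsub, -⟩ := hasUniqueGibbsMeasure_criticalBeta_holds (d := 3) (by norm_num)
  obtain ⟨μ', hμ', hTI, -⟩ :=
    exists_plusMeasure_holds (d := 3) (β := criticalBeta 3) (h := 0) (criticalBeta_nonneg 3)
  have hμμ' : μ = μ' := hsub hμ hμ'
  exact h μ hμ (hμμ' ▸ hTI)


/-! ## §2 Lattice geometry of the Σ3 rotation (coordinates made explicit for `omega`) -/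

theorem forall_fin_three {P : Fin 3 → Prop} : (∀ i, P i) ↔ P 0 ∧ P 1 ∧ P 2 :=
  ⟨fun h => ⟨h 0, h 1, h 2⟩, fun h i => by
    fin_cases i
    exacts [h.1, h.2.1, h.2.2]⟩

@[simp] theorem A_mulVec_zero (x : Fin 3 → ℤ) : Matrix.mulVec A x 0 = 2 * x 0 + 2 * x 1 - x 2 := by
  simp [A, Matrix.mulVec, dotProduct, Fin.sum_univ_three]; ring

@[simp] theorem A_mulVec_one (x : Fin 3 → ℤ) : Matrix.mulVec A x 1 = -x 0 + 2 * x 1 + 2 * x 2 := by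
  simp [A, Matrix.mulVec, dotProduct, Fin.sum_univ_three]

@[simp] theorem A_mulVec_two (x : Fin 3 → ℤ) : Matrix.mulVec A x 2 = 2 * x 0 - x 1 + 2 * x 2 := by
  simp [A, Matrix.mulVec, dotProduct, Fin.sum_univ_three]; ring

theorem mem_box_iff {n m : ℕ} {x : Site 3} : x ∈ box n m ↔
    (-(2 * (n:ℤ) * ((m:ℤ) + 1)) ≤ x 0 ∧ x 0 ≤ 2 * (n:ℤ) * ((m:ℤ) + 1)) ∧
    (-(2 * (n:ℤ) * ((m:ℤ) + 1)) ≤ x 1 ∧ x 1 ≤ 2 * (n:ℤ) * ((m:ℤ) + 1)) ∧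
    (-(2 * (n:ℤ) * ((m:ℤ) + 1)) ≤ x 2 ∧ x 2 ≤ 2 * (n:ℤ) * ((m:ℤ) + 1)) := by
  simp only [box, Fintype.mem_piFinset, Finset.mem_Icc, forall_fin_three]

theorem mem_rotCell_iff {n m : ℕ} {u : Fin 3 → ℤ} {x : Site 3} : x ∈ rotCell n m u ↔
    x ∈ box n m ∧
    (3 * (n:ℤ) * u 0 ≤ 2 * x 0 + 2 * x 1 - x 2 ∧ 2 * x 0 + 2 * x 1 - x 2 < 3 * (n:ℤ) * (u 0 + 1)) ∧
    (3 * (n:ℤ) * u 1 ≤ -x 0 + 2 * x 1 + 2 * x 2 ∧ -x 0 + 2 * x 1 + 2 * x 2 < 3 * (n:ℤ) * (u 1 + 1)) ∧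
    (3 * (n:ℤ) * u 2 ≤ 2 * x 0 - x 1 + 2 * x 2 ∧ 2 * x 0 - x 1 + 2 * x 2 < 3 * (n:ℤ) * (u 2 + 1)) := by
  simp only [rotCell, Finset.mem_filter, forall_fin_three, A_mulVec_zero, A_mulVec_one, A_mulVec_two]

theorem mem_rotCell₀_iff {n m : ℕ} {x : Site 3} : x ∈ rotCell₀ n m ↔
    x ∈ box n m ∧
    (0 ≤ 2 * x 0 + 2 * x 1 - x 2 ∧ 2 * x 0 + 2 * x 1 - x 2 < 3 * (n:ℤ)) ∧
    (0 ≤ -x 0 + 2 * x 1 + 2 * x 2 ∧ -x 0 + 2 * x 1 + 2 * x 2 < 3 * (n:ℤ)) ∧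
    (0 ≤ 2 * x 0 - x 1 + 2 * x 2 ∧ 2 * x 0 - x 1 + 2 * x 2 < 3 * (n:ℤ)) := by
  simp only [rotCell₀, Finset.mem_filter, forall_fin_three, A_mulVec_zero, A_mulVec_one, A_mulVec_two]

theorem mem_axisCell_iff {n : ℕ} {u : Fin 3 → ℤ} {x : Site 3} : x ∈ axisCell n u ↔
    ((n:ℤ) * u 0 ≤ x 0 ∧ x 0 < (n:ℤ) * u 0 + n) ∧ ((n:ℤ) * u 1 ≤ x 1 ∧ x 1 < (n:ℤ) * u 1 + n) ∧
    ((n:ℤ) * u 2 ≤ x 2 ∧ x 2 < (n:ℤ) * u 2 + n) := by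
  simp only [axisCell, Fintype.mem_piFinset, Finset.mem_Ico, forall_fin_three]

theorem mem_axisCell₀_iff {n : ℕ} {x : Site 3} : x ∈ axisCell₀ n ↔
    (0 ≤ x 0 ∧ x 0 < n) ∧ (0 ≤ x 1 ∧ x 1 < n) ∧ (0 ≤ x 2 ∧ x 2 < n) := by
  simp only [axisCell₀, Fintype.mem_piFinset, Finset.mem_Ico, forall_fin_three]

/-- The `u = 0` block of copy 1 is the normalising cell. -/
theorem rotCell_zero (n m : ℕ) : rotCell n m 0 = rotCell₀ n m := by
  ext x; simp only [mem_rotCell_iff, mem_rotCell₀_iff, Pi.zero_apply, mul_zero, zero_add, mul_one]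

/-- The `u = 0` block of copy 2 is the normalising cube. -/
theorem axisCell_zero (n : ℕ) : axisCell n 0 = axisCell₀ n := by
  ext x; simp only [mem_axisCell_iff, mem_axisCell₀_iff, Pi.zero_apply, mul_zero, zero_add]

theorem zero_mem_rotCell₀ {n : ℕ} (m : ℕ) (hn : 1 ≤ n) : (0 : Site 3) ∈ rotCell₀ n m := by
  have h0 : (0:ℤ) ≤ 2 * (n:ℤ) * ((m:ℤ) + 1) := by positivity
  simp only [mem_rotCell₀_iff, mem_box_iff, Pi.zero_apply]
  omega

/-- The block index `e₀ = (1,0,0)`. -/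
def e0 : Fin 3 → ℤ := Pi.single 0 1

@[simp] theorem e0_zero : e0 0 = 1 := by simp [e0]
@[simp] theorem e0_one : e0 1 = 0 := by simp [e0]
@[simp] theorem e0_two : e0 2 = 0 := by simp [e0]

theorem abs_e0_le (i : Fin 3) : |e0 i| ≤ (1 : ℕ) := by
  fin_cases i <;> simp

/-- For `n = 3k` the rotated cells are lattice translates: `t = k·Aᵀe₀ = (2k, 2k, -k)`. -/
def tvec (k : ℕ) : Site 3 := ![2 * (k:ℤ), 2 * (k:ℤ), -(k:ℤ)]

@[simp] theorem tvec_zero (k : ℕ) : tvec k 0 = 2 * (k:ℤ) := rfl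
@[simp] theorem tvec_one (k : ℕ) : tvec k 1 = 2 * (k:ℤ) := rfl
@[simp] theorem tvec_two (k : ℕ) : tvec k 2 = -(k:ℤ) := rfl

/-- Commensurability at work: for `n = 3k` the rotated cell of index `e₀` is the lattice translate
of the reference rotated cell by `tvec k` (both inside the window-`1` box). -/
theorem rotCell_e0_eq_map (k : ℕ) :
    rotCell (3 * k) 1 e0 = (rotCell₀ (3 * k) 1).map (addRightEmbedding (tvec k)) := by
  ext x
  simp only [Finset.mem_map, addRightEmbedding_apply, mem_rotCell_iff, mem_rotCell₀_iff, mem_box_iff,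
    e0_zero, e0_one, e0_two]
  push_cast
  constructor
  · rintro h
    refine ⟨x - tvec k, ?_, ?_⟩
    · simp only [Pi.sub_apply, tvec_zero, tvec_one, tvec_two]
      omega
    · ext i; fin_cases i <;> simp
  · rintro ⟨y, hy, rfl⟩
    simp only [Pi.add_apply, tvec_zero, tvec_one, tvec_two]
    omega

/-- The axis cell of index `e₀` is the translate of the reference cube by `n e₀`. -/
theorem axisCell_e0_eq_map (n : ℕ) :
    axisCell n e0 = (axisCell₀ n).map (addRightEmbedding (Pi.single 0 (n:ℤ))) := by
  ext x
  simp only [Finset.mem_map, addRightEmbedding_apply, mem_axisCell_iff, mem_axisCell₀_iff,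
    e0_zero, e0_one, e0_two]
  constructor
  · rintro h
    refine ⟨x - Pi.single 0 (n:ℤ), ?_, ?_⟩
    · simp only [Pi.sub_apply, Pi.single_eq_same, Pi.single_eq_of_ne (by decide : (1 : Fin 3) ≠ 0),
        Pi.single_eq_of_ne (by decide : (2 : Fin 3) ≠ 0)]
      omega
    · ext i; fin_cases i <;> simp
  · rintro ⟨y, hy, rfl⟩
    simp only [Pi.add_apply, Pi.single_eq_same, Pi.single_eq_of_ne (by decide : (1 : Fin 3) ≠ 0),
        Pi.single_eq_of_ne (by decide : (2 : Fin 3) ≠ 0)]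
    omega

/-- The third coordinate on the reference rotated cell at `n = 3k` lies in `[-k+1, 4k-1]`
(`9 x₂ = -(Ax)₀ + 2(Ax)₁ + 2(Ax)₂`). -/
theorem layer_bounds_of_mem_rotCell₀ {k : ℕ} {x : Site 3} (hx : x ∈ rotCell₀ (3 * k) 1) :
    -(k:ℤ) + 1 ≤ x 2 ∧ x 2 ≤ 4 * (k:ℤ) - 1 := by
  simp only [mem_rotCell₀_iff, mem_box_iff] at hx
  push_cast at hx
  omega


/-! ## §3 A telescoping (discrete Poincaré) inequality for finitely supported sequences -/

/-- If `f : ℤ → ℝ` vanishes off `[a, a + p·s)`, then `Σ f² ≤ p² Σ_j (f j - f (j+s))²` (sums over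
any finite `K ⊇ [a, a + 2ps)`): a profile cannot be almost invariant under a shift that is a fixed
fraction of its support. -/
theorem sum_sq_le_sq_mul_sum_sq_sub_shift (f : ℤ → ℝ) (a : ℤ) (s p : ℕ)
    (hsupp : ∀ j, f j ≠ 0 → a ≤ j ∧ j < a + p * s) (K : Finset ℤ)
    (hK : ∀ j, a ≤ j → j < a + 2 * p * s → j ∈ K) :
    ∑ j ∈ K, f j ^ 2 ≤ (p:ℝ) ^ 2 * ∑ j ∈ K, (f j - f (j + s)) ^ 2 := by
  classical
  set D : ℤ → ℝ := fun j => (f j - f (j + s)) ^ 2 with hD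
  have hDnn : ∀ j, 0 ≤ D j := fun j => sq_nonneg _
  set J : Finset ℤ := K.filter (fun j => a ≤ j ∧ j < a + p * s) with hJ
  -- telescoping representation on `j ≥ a`
  have htel : ∀ j, a ≤ j → f j = ∑ i ∈ Finset.range p, (f (j + i * s) - f (j + (i + 1) * s)) := by
    intro j hj
    have h := Finset.sum_range_sub' (fun i : ℕ => f (j + i * s)) p
    simp only [Nat.cast_zero, zero_mul, add_zero, Nat.cast_add, Nat.cast_one] at h
    have hzero : f (j + p * s) = 0 := by
      by_contra hne
      have := (hsupp _ hne).2
      nlinarith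
    rw [h, hzero, sub_zero]
  -- Cauchy–Schwarz per point
  have hpt : ∀ j, a ≤ j → f j ^ 2 ≤ (p:ℝ) * ∑ i ∈ Finset.range p, D (j + i * s) := by
    intro j hj
    have h1 := sq_sum_le_card_mul_sum_sq (s := Finset.range p)
      (f := fun i : ℕ => f (j + i * s) - f (j + (i + 1) * s))
    rw [← htel j hj, Finset.card_range] at h1
    refine h1.trans (le_of_eq ?_)
    congr 1
    refine Finset.sum_congr rfl (fun i _ => ?_)
    simp only [hD]
    ring_nf
  -- restrict the left sum to J
  have hKJ : ∑ j ∈ K, f j ^ 2 = ∑ j ∈ J, f j ^ 2 := by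
    rw [hJ, Finset.sum_filter]
    refine Finset.sum_congr rfl (fun j _ => ?_)
    split_ifs with h
    · rfl
    · have : f j = 0 := by
        by_contra hne
        exact h (hsupp j hne)
      simp [this]
  -- shifted sums are dominated by the full sum
  have hshift : ∀ i ∈ Finset.range p, ∑ j ∈ J, D (j + i * s) ≤ ∑ j ∈ K, D j := by
    intro i hi
    rw [Finset.mem_range] at hi
    have hinj : Set.InjOn (fun j : ℤ => j + i * s) J := fun x _ y _ hxy => by simpa using hxy
    rw [← Finset.sum_image (f := D) hinj]
    refine Finset.sum_le_sum_of_subset_of_nonneg ?_ (fun j _ _ => hDnn j)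
    intro x hx
    rw [Finset.mem_image] at hx
    obtain ⟨j, hj, rfl⟩ := hx
    rw [hJ, Finset.mem_filter] at hj
    have hi' : (i:ℤ) + 1 ≤ p := by exact_mod_cast hi
    apply hK
    · nlinarith [hj.2.1]
    · nlinarith [hj.2.2]
  calc ∑ j ∈ K, f j ^ 2 = ∑ j ∈ J, f j ^ 2 := hKJ
    _ ≤ ∑ j ∈ J, (p:ℝ) * ∑ i ∈ Finset.range p, D (j + i * s) :=
        Finset.sum_le_sum (fun j hj => hpt j (by rw [hJ, Finset.mem_filter] at hj; exact hj.2.1))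
    _ = (p:ℝ) * ∑ i ∈ Finset.range p, ∑ j ∈ J, D (j + i * s) := by
        rw [← Finset.mul_sum, Finset.sum_comm]
    _ ≤ (p:ℝ) * ∑ i ∈ Finset.range p, ∑ j ∈ K, D j := by
        gcongr with i hi
        exact hshift i hi
    _ = (p:ℝ) ^ 2 * ∑ j ∈ K, (f j - f (j + s)) ^ 2 := by
        rw [Finset.sum_const, Finset.card_range, nsmul_eq_mul]; ring

/-! ## §4 The DLR hypothesis is load-bearing: a translation-invariant counter-measure

`μL` = horizontally layered i.i.d. fair spins (`σ_x = ε_{x₂}`, `(ε_j)_{j∈ℤ}` i.i.d. ±1). Under ANY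
coupling `π` of `μL` with itself the axis blocks `0` and `e₀` of copy 2 coincide exactly, while the
rotated blocks `0` and `e₀` of copy 1 differ in `L²` by a fixed fraction of their norm (their layer
profiles are shifts of each other by `n/3`); the two defects at `u = 0` and `u = e₀` therefore cannot
both be small: `max ≥ 1/150` at every scale `n = 3k`. -/

/-- Fair coin on `ℤˣ = {1, -1}`. -/
def coin : Measure ℤˣ := (2:ENNReal)⁻¹ • Measure.dirac 1 + (2:ENNReal)⁻¹ • Measure.dirac (-1)

instance coin_isProbabilityMeasure : IsProbabilityMeasure coin :=
  ⟨by simp [coin, ENNReal.inv_two_add_inv_two]⟩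

theorem integral_coin (f : ℤˣ → ℝ) : ∫ u, f u ∂coin = 2⁻¹ * f 1 + 2⁻¹ * f (-1) := by
  simp only [coin]
  rw [integral_add_measure (Integrable.of_finite.smul_measure (by simp))
    (Integrable.of_finite.smul_measure (by simp)), integral_smul_measure,
    integral_smul_measure, integral_dirac, integral_dirac]
  simp

/-- i.i.d. fair spins indexed by the layers `ℤ`. -/
def P : Measure (ℤ → ℤˣ) := Measure.infinitePi (fun _ : ℤ => coin)

instance P_isProbabilityMeasure : IsProbabilityMeasure P := by
  unfold P; infer_instance

/-- The layering map `σ_x := ε_{x₂}`: configurations constant on the planes `x₂ = const`. -/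
def layer (ε : ℤ → ℤˣ) : SpinConfig (Site 3) := fun x => ε (x 2)

@[fun_prop]
theorem measurable_layer : Measurable layer :=
  measurable_pi_lambda _ (fun x => measurable_pi_apply (x 2))

theorem spinAt_layer (x : Site 3) (ε : ℤ → ℤˣ) : spinAt x (layer ε) = spinAt (x 2) ε := rfl

/-- The counter-measure: horizontally layered i.i.d. fair spins. -/
def μL : Measure (SpinConfig (Site 3)) := P.map layer

instance μL_isProbabilityMeasure : IsProbabilityMeasure μL :=
  Measure.isProbabilityMeasure_map measurable_layer.aemeasurable

/-- `μL` is translation invariant (a shift of `ℤ³` acts on the layers by a shift of `ℤ`). -/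
theorem isTranslationInvariant_μL : IsTranslationInvariantMeasure μL := by
  intro v
  have hre : Measurable (fun (ε : ℤ → ℤˣ) (j : ℤ) => ε (Equiv.subRight (v 2) j)) :=
    measurable_pi_lambda _ (fun j => measurable_pi_apply _)
  have hcomp : (configShift v) ∘ layer =
      layer ∘ (fun (ε : ℤ → ℤˣ) (j : ℤ) => ε (Equiv.subRight (v 2) j)) := by
    funext ε; funext x
    simp [layer, configShift_apply, Equiv.subRight_apply]
  unfold μL
  rw [Measure.map_map (configShift v).measurable measurable_layer, hcomp,
    ← Measure.map_map measurable_layer hre]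
  unfold P
  rw [map_reindex_infinitePi coin (Equiv.subRight (v 2))]

/-! ### Moments of the layer spins -/

theorem integral_spinAt_P (j : ℤ) : ∫ ε, spinAt j ε ∂P = 0 := by
  have h1 : ∫ ε, spinAt j ε ∂P = ∫ u : ℤˣ, (((u : ℤˣ) : ℤ) : ℝ) ∂(P.map (fun ε : ℤ → ℤˣ => ε j)) := by
    rw [integral_map (measurable_pi_apply j).aemeasurable
      (measurable_of_countable _).aestronglyMeasurable]
    rfl
  rw [h1]
  unfold P
  rw [Measure.infinitePi_map_eval (fun _ : ℤ => coin) j, integral_coin]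
  simp

theorem dependsOn_spinAt (j : ℤ) : DependsOn (fun ε : ℤ → ℤˣ => spinAt j ε) ({j} : Finset ℤ) := by
  intro x y hxy
  simp only [spinAt, hxy j (by simp)]

theorem integral_spinAt_mul_spinAt_P (i j : ℤ) :
    ∫ ε, spinAt i ε * spinAt j ε ∂P = if i = j then 1 else 0 := by
  classical
  split_ifs with h
  · subst h
    simp [← sq]
  · have := integral_mul_eq_of_dependsOn_disjoint (fun _ : ℤ => coin) (S := {i}) (T := {j})
      (Finset.disjoint_singleton.2 h) (measurable_spinAt i) (measurable_spinAt j)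
      (dependsOn_spinAt i) (dependsOn_spinAt j)
    unfold P
    rw [this]
    change (∫ ε, spinAt i ε ∂P) * ∫ ε, spinAt j ε ∂P = 0
    rw [integral_spinAt_P, zero_mul]

theorem integrable_of_abs_le {Ω : Type*} [MeasurableSpace Ω] {μ : Measure Ω} [IsFiniteMeasure μ]
    {f : Ω → ℝ} (hf : Measurable f) (B : ℝ) (hB : ∀ x, |f x| ≤ B) : Integrable f μ :=
  Integrable.of_bound hf.aestronglyMeasurable B
    (ae_of_all _ (fun x => by rw [Real.norm_eq_abs]; exact hB x))

/-- Second moment of a linear form in i.i.d. fair spins: `E[(Σ c_j ε_j)²] = Σ c_j²`. -/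
theorem integral_sq_linear_P (K : Finset ℤ) (c : ℤ → ℝ) :
    ∫ ε, (∑ j ∈ K, c j * spinAt j ε) ^ 2 ∂P = ∑ j ∈ K, c j ^ 2 := by
  classical
  have hint : ∀ i j, Integrable (fun ε : ℤ → ℤˣ => c i * spinAt i ε * (c j * spinAt j ε)) P := by
    intro i j
    refine integrable_of_abs_le (by fun_prop) (|c i| * |c j|) (fun ε => ?_)
    rw [abs_mul, abs_mul, abs_mul, abs_spinAt, abs_spinAt]; simp
  calc ∫ ε, (∑ j ∈ K, c j * spinAt j ε) ^ 2 ∂P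
      = ∫ ε, ∑ i ∈ K, ∑ j ∈ K, c i * spinAt i ε * (c j * spinAt j ε) ∂P := by
          congr 1; funext ε; rw [sq, Finset.sum_mul_sum]
    _ = ∑ i ∈ K, ∑ j ∈ K, ∫ ε, c i * spinAt i ε * (c j * spinAt j ε) ∂P := by
          rw [integral_finsetSum _ (fun i _ => integrable_finsetSum _ (fun j _ => hint i j))]
          refine Finset.sum_congr rfl (fun i _ => ?_)
          rw [integral_finsetSum _ (fun j _ => hint i j)]
    _ = ∑ i ∈ K, ∑ j ∈ K, c i * c j * (if i = j then 1 else 0) := by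
          refine Finset.sum_congr rfl (fun i _ => Finset.sum_congr rfl (fun j _ => ?_))
          have : (fun ε : ℤ → ℤˣ => c i * spinAt i ε * (c j * spinAt j ε)) =
              fun ε => (c i * c j) * (spinAt i ε * spinAt j ε) := by funext ε; ring
          rw [this, integral_const_mul, integral_spinAt_mul_spinAt_P]
    _ = ∑ i ∈ K, c i ^ 2 := by
          refine Finset.sum_congr rfl (fun i hi => ?_)
          simp [mul_ite, Finset.sum_ite_eq, hi, sq]

/-! ### Block sums of layered configurations: layer profiles -/

/-- The layer profile of a finite set of sites: number of its points on the plane `x₂ = j`. -/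
def profile (s : Finset (Site 3)) (j : ℤ) : ℝ := ((s.filter (fun x => x 2 = j)).card : ℝ)

theorem blockSum_layer (s : Finset (Site 3)) (K : Finset ℤ) (hK : ∀ x ∈ s, x 2 ∈ K) (ε : ℤ → ℤˣ) :
    blockSum s (layer ε) = ∑ j ∈ K, profile s j * spinAt j ε := by
  unfold blockSum profile
  simp_rw [spinAt_layer]
  have h := Finset.sum_fiberwise_of_maps_to' (s := s) (t := K) (g := fun x : Site 3 => x 2) hK
    (fun j => spinAt j ε)
  rw [← h]
  refine Finset.sum_congr rfl fun j _ => ?_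
  rw [Finset.sum_const, nsmul_eq_mul]

theorem profile_map_addRight (s : Finset (Site 3)) (t : Site 3) (j : ℤ) :
    profile (s.map (addRightEmbedding t)) j = profile s (j - t 2) := by
  unfold profile
  rw [Finset.filter_map, Finset.card_map]
  congr 2
  refine Finset.filter_congr (fun x _ => ?_)
  simp only [Function.comp_apply, addRightEmbedding_apply, Pi.add_apply]
  omega

theorem blockSum_map_addRight (s : Finset (Site 3)) (t : Site 3) (σ : SpinConfig (Site 3)) :
    blockSum (s.map (addRightEmbedding t)) σ = ∑ x ∈ s, spinAt (x + t) σ := by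
  unfold blockSum
  rw [Finset.sum_map]
  rfl

@[fun_prop]
theorem measurable_blockSum (s : Finset (Site 3)) : Measurable (blockSum s) := by
  unfold blockSum
  exact Finset.measurable_sum _ (fun x _ => measurable_spinAt x)

theorem abs_blockSum_le (s : Finset (Site 3)) (σ : SpinConfig (Site 3)) : |blockSum s σ| ≤ s.card := by
  unfold blockSum
  calc |∑ x ∈ s, spinAt x σ| ≤ ∑ x ∈ s, |spinAt x σ| := Finset.abs_sum_le_sum_abs _ _
    _ = s.card := by simp

/-! ### The two cells at scale `n = 3k` read through `μL` -/

/-- A window of layers containing every layer met by the cells in play. -/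
def Kwin (k : ℕ) : Finset ℤ := Finset.Icc (-(20 * (k:ℤ))) (20 * (k:ℤ))

theorem layer_mem_Kwin_of_mem_rotCell₀ {k : ℕ} {x : Site 3} (hx : x ∈ rotCell₀ (3 * k) 1) :
    x 2 ∈ Kwin k := by
  have := layer_bounds_of_mem_rotCell₀ hx
  rw [Kwin, Finset.mem_Icc]; omega

theorem blockSum_rotCell₀_layer (k : ℕ) (ε : ℤ → ℤˣ) :
    blockSum (rotCell₀ (3 * k) 1) (layer ε) =
      ∑ j ∈ Kwin k, profile (rotCell₀ (3 * k) 1) j * spinAt j ε :=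
  blockSum_layer _ _ (fun _ hx => layer_mem_Kwin_of_mem_rotCell₀ hx) ε

theorem blockSum_rotCell_e0_layer (k : ℕ) (ε : ℤ → ℤˣ) :
    blockSum (rotCell (3 * k) 1 e0) (layer ε) =
      ∑ j ∈ Kwin k, profile (rotCell₀ (3 * k) 1) (j + k) * spinAt j ε := by
  rw [rotCell_e0_eq_map]
  have hK : ∀ x ∈ (rotCell₀ (3 * k) 1).map (addRightEmbedding (tvec k)), x 2 ∈ Kwin k := by
    intro x hx
    rw [Finset.mem_map] at hx
    obtain ⟨y, hy, rfl⟩ := hx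
    have := layer_bounds_of_mem_rotCell₀ hy
    simp only [addRightEmbedding_apply, Pi.add_apply, tvec_two, Kwin, Finset.mem_Icc]
    omega
  rw [blockSum_layer _ _ hK]
  refine Finset.sum_congr rfl fun j _ => ?_
  rw [profile_map_addRight, tvec_two, sub_neg_eq_add]

theorem blockSum_axisCell_e0_layer (n : ℕ) (ε : ℤ → ℤˣ) :
    blockSum (axisCell n e0) (layer ε) = blockSum (axisCell₀ n) (layer ε) := by
  rw [axisCell_e0_eq_map, blockSum_map_addRight]
  unfold blockSum
  refine Finset.sum_congr rfl fun x _ => ?_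
  simp [spinAt_layer]

/-- `V₀(k) = E[(block sum of the reference rotated cell)²] = Σ_j profile_j²`. -/
def V0 (k : ℕ) : ℝ := ∑ j ∈ Kwin k, profile (rotCell₀ (3 * k) 1) j ^ 2

/-- `V₁(k) = E[(difference of the two rotated block sums)²] = Σ_j (profile_j - profile_{j+k})²`. -/
def V1 (k : ℕ) : ℝ := ∑ j ∈ Kwin k, (profile (rotCell₀ (3 * k) 1) j - profile (rotCell₀ (3 * k) 1) (j + k)) ^ 2

theorem integral_sq_blockSum_rotCell₀ (k : ℕ) :
    ∫ ε, (blockSum (rotCell₀ (3 * k) 1) (layer ε)) ^ 2 ∂P = V0 k := by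
  simp_rw [blockSum_rotCell₀_layer]
  exact integral_sq_linear_P _ _

theorem integral_sq_blockSum_sub (k : ℕ) :
    ∫ ε, (blockSum (rotCell₀ (3 * k) 1) (layer ε) - blockSum (rotCell (3 * k) 1 e0) (layer ε)) ^ 2 ∂P
      = V1 k := by
  simp_rw [blockSum_rotCell₀_layer, blockSum_rotCell_e0_layer, ← Finset.sum_sub_distrib, ← sub_mul]
  exact integral_sq_linear_P _ _

theorem one_le_V0 {k : ℕ} (hk : 1 ≤ k) : 1 ≤ V0 k := by
  have h0 : (0 : Site 3) ∈ rotCell₀ (3 * k) 1 := zero_mem_rotCell₀ 1 (by omega)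
  have hprof : 1 ≤ profile (rotCell₀ (3 * k) 1) 0 := by
    unfold profile
    have : 0 < ((rotCell₀ (3 * k) 1).filter (fun x => x 2 = 0)).card :=
      Finset.card_pos.2 ⟨0, Finset.mem_filter.2 ⟨h0, rfl⟩⟩
    exact_mod_cast this
  have hmem : (0:ℤ) ∈ Kwin k := by rw [Kwin, Finset.mem_Icc]; omega
  calc (1:ℝ) ≤ profile (rotCell₀ (3 * k) 1) 0 ^ 2 := by nlinarith
    _ ≤ V0 k := Finset.single_le_sum (f := fun j => profile (rotCell₀ (3 * k) 1) j ^ 2)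
        (fun j _ => sq_nonneg _) hmem

theorem V0_le (k : ℕ) : V0 k ≤ 25 * V1 k := by
  have h := sum_sq_le_sq_mul_sum_sq_sub_shift (profile (rotCell₀ (3 * k) 1)) (-(k:ℤ) + 1) k 5
    (fun j hj => ?_) (Kwin k) (fun j h1 h2 => ?_)
  · norm_num at h
    exact h
  · -- support of the profile
    unfold profile at hj
    have hne : ((rotCell₀ (3 * k) 1).filter (fun x => x 2 = j)).Nonempty := by
      rw [← Finset.card_pos]
      have : ((rotCell₀ (3 * k) 1).filter (fun x => x 2 = j)).card ≠ 0 := by exact_mod_cast hj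
      omega
    obtain ⟨x, hx⟩ := hne
    rw [Finset.mem_filter] at hx
    have := layer_bounds_of_mem_rotCell₀ hx.1
    push_cast
    omega
  · rw [Kwin, Finset.mem_Icc]
    push_cast at h2
    omega


theorem V0_nonneg (k : ℕ) : 0 ≤ V0 k := Finset.sum_nonneg (fun _ _ => sq_nonneg _)

/-! ## §5 No coupling of `μL` with itself has a small rotation defect at two adjacent blocks -/

theorem integral_μL {f : SpinConfig (Site 3) → ℝ} (hf : Measurable f) :
    ∫ σ, f σ ∂μL = ∫ ε, f (layer ε) ∂P := by
  unfold μL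
  exact integral_map measurable_layer.aemeasurable hf.aestronglyMeasurable

theorem integrable_sq_sub {Ω : Type*} [MeasurableSpace Ω] {μ : Measure Ω} [IsFiniteMeasure μ]
    {f g : Ω → ℝ} (hf : Measurable f) (hg : Measurable g) {Bf Bg : ℝ}
    (hBf : ∀ x, |f x| ≤ Bf) (hBg : ∀ x, |g x| ≤ Bg) :
    Integrable (fun x => (f x - g x) ^ 2) μ := by
  refine integrable_of_abs_le ((hf.sub hg).pow_const 2) ((Bf + Bg) ^ 2) (fun x => ?_)
  rw [abs_pow]
  have h1 : |f x - g x| ≤ Bf + Bg := (abs_sub _ _).trans (add_le_add (hBf x) (hBg x))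
  exact pow_le_pow_left₀ (abs_nonneg _) h1 2

theorem abs_const_mul_blockSum_le (c : ℝ) (s : Finset (Site 3)) (σ : SpinConfig (Site 3)) :
    |c * blockSum s σ| ≤ |c| * s.card := by
  rw [abs_mul]
  exact mul_le_mul_of_nonneg_left (abs_blockSum_le s σ) (abs_nonneg c)

/-- Copy 1, reference rotated block (normalised). -/
def Fk (k : ℕ) (q : SpinConfig (Site 3) × SpinConfig (Site 3)) : ℝ :=
  normaliser μL (rotCell₀ (3 * k) 1) * blockSum (rotCell₀ (3 * k) 1) q.1

/-- Copy 1, rotated block `e₀` (normalised by the reference cell, as in the crux). -/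
def Gk (k : ℕ) (q : SpinConfig (Site 3) × SpinConfig (Site 3)) : ℝ :=
  normaliser μL (rotCell₀ (3 * k) 1) * blockSum (rotCell (3 * k) 1 e0) q.1

/-- Copy 2, reference axis block (normalised). -/
def Hk (k : ℕ) (q : SpinConfig (Site 3) × SpinConfig (Site 3)) : ℝ :=
  normaliser μL (axisCell₀ (3 * k)) * blockSum (axisCell₀ (3 * k)) q.2

/-- Copy 2, axis block `e₀` (normalised). -/
def Kk (k : ℕ) (q : SpinConfig (Site 3) × SpinConfig (Site 3)) : ℝ :=
  normaliser μL (axisCell₀ (3 * k)) * blockSum (axisCell (3 * k) e0) q.2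

@[fun_prop] theorem measurable_Fk (k : ℕ) : Measurable (Fk k) := by unfold Fk; fun_prop
@[fun_prop] theorem measurable_Gk (k : ℕ) : Measurable (Gk k) := by unfold Gk; fun_prop
@[fun_prop] theorem measurable_Hk (k : ℕ) : Measurable (Hk k) := by unfold Hk; fun_prop
@[fun_prop] theorem measurable_Kk (k : ℕ) : Measurable (Kk k) := by unfold Kk; fun_prop

theorem abs_Fk_le (k : ℕ) (q : SpinConfig (Site 3) × SpinConfig (Site 3)) :
    |Fk k q| ≤ |normaliser μL (rotCell₀ (3 * k) 1)| * (rotCell₀ (3 * k) 1).card :=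
  abs_const_mul_blockSum_le _ _ _

theorem abs_Gk_le (k : ℕ) (q : SpinConfig (Site 3) × SpinConfig (Site 3)) :
    |Gk k q| ≤ |normaliser μL (rotCell₀ (3 * k) 1)| * (rotCell (3 * k) 1 e0).card :=
  abs_const_mul_blockSum_le _ _ _

theorem abs_Hk_le (k : ℕ) (q : SpinConfig (Site 3) × SpinConfig (Site 3)) :
    |Hk k q| ≤ |normaliser μL (axisCell₀ (3 * k))| * (axisCell₀ (3 * k)).card :=
  abs_const_mul_blockSum_le _ _ _

theorem abs_Kk_le (k : ℕ) (q : SpinConfig (Site 3) × SpinConfig (Site 3)) :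
    |Kk k q| ≤ |normaliser μL (axisCell₀ (3 * k))| * (axisCell (3 * k) e0).card :=
  abs_const_mul_blockSum_le _ _ _

theorem defect_zero_eq (k : ℕ) (π : Measure (SpinConfig (Site 3) × SpinConfig (Site 3))) :
    defect μL (3 * k) 1 0 π = ∫ q, (Fk k q - Hk k q) ^ 2 ∂π := by
  unfold defect Fk Hk
  rw [rotCell_zero, axisCell_zero]

theorem defect_e0_eq (k : ℕ) (π : Measure (SpinConfig (Site 3) × SpinConfig (Site 3))) :
    defect μL (3 * k) 1 e0 π = ∫ q, (Kk k q - Gk k q) ^ 2 ∂π := by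
  unfold defect Gk Kk
  congr 1; funext q; ring

/-- Under any coupling with second marginal `μL`, the two axis blocks of copy 2 coincide. -/
theorem integral_HK_sq (k : ℕ) (π : Measure (SpinConfig (Site 3) × SpinConfig (Site 3)))
    (hsnd : π.snd = μL) : ∫ q, (Hk k q - Kk k q) ^ 2 ∂π = 0 := by
  have hmeas : Measurable (fun σ : SpinConfig (Site 3) =>
      (normaliser μL (axisCell₀ (3 * k)) * blockSum (axisCell₀ (3 * k)) σ -
        normaliser μL (axisCell₀ (3 * k)) * blockSum (axisCell (3 * k) e0) σ) ^ 2) := by fun_prop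
  have h1 : ∫ q, (Hk k q - Kk k q) ^ 2 ∂π =
      ∫ σ, (normaliser μL (axisCell₀ (3 * k)) * blockSum (axisCell₀ (3 * k)) σ -
        normaliser μL (axisCell₀ (3 * k)) * blockSum (axisCell (3 * k) e0) σ) ^ 2 ∂(π.map Prod.snd) :=
    (integral_map measurable_snd.aemeasurable hmeas.aestronglyMeasurable).symm
  have hsnd' : π.map Prod.snd = μL := hsnd
  rw [h1, hsnd', integral_μL (by fun_prop)]
  simp [blockSum_axisCell_e0_layer]

/-- Under any coupling with first marginal `μL`, the two rotated blocks of copy 1 differ by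
`α² · V₁(k)` in `L²`. -/
theorem integral_FG_sq (k : ℕ) (π : Measure (SpinConfig (Site 3) × SpinConfig (Site 3)))
    (hfst : π.fst = μL) :
    ∫ q, (Fk k q - Gk k q) ^ 2 ∂π = (normaliser μL (rotCell₀ (3 * k) 1)) ^ 2 * V1 k := by
  have hmeas : Measurable (fun σ : SpinConfig (Site 3) =>
      (normaliser μL (rotCell₀ (3 * k) 1) * blockSum (rotCell₀ (3 * k) 1) σ -
        normaliser μL (rotCell₀ (3 * k) 1) * blockSum (rotCell (3 * k) 1 e0) σ) ^ 2) := by fun_prop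
  have h1 : ∫ q, (Fk k q - Gk k q) ^ 2 ∂π =
      ∫ σ, (normaliser μL (rotCell₀ (3 * k) 1) * blockSum (rotCell₀ (3 * k) 1) σ -
        normaliser μL (rotCell₀ (3 * k) 1) * blockSum (rotCell (3 * k) 1 e0) σ) ^ 2 ∂(π.map Prod.fst) :=
    (integral_map measurable_fst.aemeasurable hmeas.aestronglyMeasurable).symm
  have hfst' : π.map Prod.fst = μL := hfst
  rw [h1, hfst', integral_μL (by fun_prop)]
  have h2 : ∀ ε, (normaliser μL (rotCell₀ (3 * k) 1) * blockSum (rotCell₀ (3 * k) 1) (layer ε) -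
      normaliser μL (rotCell₀ (3 * k) 1) * blockSum (rotCell (3 * k) 1 e0) (layer ε)) ^ 2 =
      (normaliser μL (rotCell₀ (3 * k) 1)) ^ 2 *
        (blockSum (rotCell₀ (3 * k) 1) (layer ε) - blockSum (rotCell (3 * k) 1 e0) (layer ε)) ^ 2 :=
    fun ε => by ring
  simp_rw [h2]
  rw [integral_const_mul, integral_sq_blockSum_sub]

/-- The self-normalisation of copy 1 read through `μL`: `α² = 1 / V₀(k)`. -/
theorem normaliser_rotCell₀_sq (k : ℕ) : (normaliser μL (rotCell₀ (3 * k) 1)) ^ 2 = (V0 k)⁻¹ := by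
  unfold normaliser
  rw [integral_μL (by fun_prop), integral_sq_blockSum_rotCell₀, inv_pow, Real.sq_sqrt (V0_nonneg k)]

/-- KEY ESTIMATE. For every coupling `π` of `μL` with itself and every `B` bounding the crux's
defect at the two blocks `u = 0` and `u = e₀` (scale `n = 3k`, window `m = 1`): `1/25 ≤ 6B`. -/
theorem defect_pair_lower_bound {k : ℕ} (hk : 1 ≤ k)
    (π : Measure (SpinConfig (Site 3) × SpinConfig (Site 3))) (hfst : π.fst = μL) (hsnd : π.snd = μL)
    {B : ℝ} (hD0 : defect μL (3 * k) 1 0 π ≤ B) (hD1 : defect μL (3 * k) 1 e0 π ≤ B) :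
    (1:ℝ) / 25 ≤ 6 * B := by
  haveI : IsProbabilityMeasure π := ⟨by rw [← Measure.fst_univ, hfst]; exact measure_univ⟩
  rw [defect_zero_eq] at hD0
  rw [defect_e0_eq] at hD1
  have hI1 : Integrable (fun q => (Fk k q - Hk k q) ^ 2) π :=
    integrable_sq_sub (measurable_Fk k) (measurable_Hk k) (abs_Fk_le k) (abs_Hk_le k)
  have hI2 : Integrable (fun q => (Hk k q - Kk k q) ^ 2) π :=
    integrable_sq_sub (measurable_Hk k) (measurable_Kk k) (abs_Hk_le k) (abs_Kk_le k)
  have hI3 : Integrable (fun q => (Kk k q - Gk k q) ^ 2) π :=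
    integrable_sq_sub (measurable_Kk k) (measurable_Gk k) (abs_Kk_le k) (abs_Gk_le k)
  have hI0 : Integrable (fun q => (Fk k q - Gk k q) ^ 2) π :=
    integrable_sq_sub (measurable_Fk k) (measurable_Gk k) (abs_Fk_le k) (abs_Gk_le k)
  have hpt : ∀ q, (Fk k q - Gk k q) ^ 2 ≤
      3 * ((Fk k q - Hk k q) ^ 2 + (Hk k q - Kk k q) ^ 2 + (Kk k q - Gk k q) ^ 2) := by
    intro q
    nlinarith [sq_nonneg (Fk k q - Hk k q - (Hk k q - Kk k q)),
      sq_nonneg (Hk k q - Kk k q - (Kk k q - Gk k q)), sq_nonneg (Fk k q - Hk k q - (Kk k q - Gk k q))]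
  have hle : ∫ q, (Fk k q - Gk k q) ^ 2 ∂π ≤
      3 * (∫ q, (Fk k q - Hk k q) ^ 2 ∂π + ∫ q, (Hk k q - Kk k q) ^ 2 ∂π +
        ∫ q, (Kk k q - Gk k q) ^ 2 ∂π) := by
    calc ∫ q, (Fk k q - Gk k q) ^ 2 ∂π
        ≤ ∫ q, 3 * ((Fk k q - Hk k q) ^ 2 + (Hk k q - Kk k q) ^ 2 + (Kk k q - Gk k q) ^ 2) ∂π :=
          integral_mono hI0 (((hI1.add hI2).add hI3).const_mul 3) hpt
      _ = 3 * (∫ q, (Fk k q - Hk k q) ^ 2 ∂π + ∫ q, (Hk k q - Kk k q) ^ 2 ∂π +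
            ∫ q, (Kk k q - Gk k q) ^ 2 ∂π) := by
          have hI12 : Integrable (fun q => (Fk k q - Hk k q) ^ 2 + (Hk k q - Kk k q) ^ 2) π :=
            hI1.add hI2
          rw [integral_const_mul, integral_add hI12 hI3, integral_add hI1 hI2]
  rw [integral_HK_sq k π hsnd, integral_FG_sq k π hfst, normaliser_rotCell₀_sq] at hle
  have hV0 : 1 ≤ V0 k := one_le_V0 hk
  have hV1 : V0 k ≤ 25 * V1 k := V0_le k
  have hpos : 0 < V0 k := by linarith
  have hkey : (1:ℝ) / 25 ≤ (V0 k)⁻¹ * V1 k := by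
    rw [inv_mul_eq_div, le_div_iff₀ hpos]
    linarith
  linarith

/-- `μL` admits NO power-rate rotation joining: the crux body fails for it. -/
theorem not_RJBody_μL : ¬ RJBody μL := by
  rintro ⟨C, θ, hθ, H⟩
  have key : ∀ k : ℕ, 1 ≤ k → (1:ℝ) / 25 ≤ 6 * (C * (((3 * k : ℕ) : ℝ)) ^ (-θ)) := by
    intro k hk
    obtain ⟨π, hfst, hsnd, Hu⟩ := H (3 * k) 1 (by omega)
    exact defect_pair_lower_bound hk π hfst hsnd (Hu 0 (fun i => by simp)) (Hu e0 abs_e0_le)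
  have h3' : Tendsto (fun k : ℕ => 3 * k) atTop atTop :=
    tendsto_atTop_atTop.2 (fun b => ⟨b, fun a ha => by omega⟩)
  have h3 : Tendsto (fun k : ℕ => ((3 * k : ℕ) : ℝ)) atTop atTop :=
    tendsto_natCast_atTop_atTop.comp h3'
  have hlim : Tendsto (fun k : ℕ => 6 * (C * (((3 * k : ℕ) : ℝ)) ^ (-θ))) atTop
      (nhds (6 * (C * 0))) :=
    (((tendsto_rpow_neg_atTop hθ).comp h3).const_mul C).const_mul 6
  rw [mul_zero, mul_zero] at hlim
  have hev : ∀ᶠ k : ℕ in atTop, 6 * (C * (((3 * k : ℕ) : ℝ)) ^ (-θ)) ∈ Set.Iio ((1:ℝ) / 25) :=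
    hlim.eventually_mem (Iio_mem_nhds (by norm_num))
  obtain ⟨k, hk1, hk2⟩ := (hev.and (eventually_ge_atTop 1)).exists
  exact absurd (key k hk2) (not_le.2 hk1)

/-! ## §6 The load-bearing analysis, stated against the crux -/

/-- The crux with the DLR (Gibbs, criticality) hypothesis DROPPED, keeping only that `μ` is a
translation-invariant probability measure on spin configurations. -/
def RotationJoiningWithoutGibbs : Prop :=
  ∀ μ : Measure (SpinConfig (Site 3)), IsProbabilityMeasure μ → IsTranslationInvariantMeasure μ →
    RJBody μ

/-- `RotationJoiningWithoutGibbs` is a genuine weakening of the hypotheses of the crux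
(Gibbs measures are probability measures), hence a strengthening of the statement. -/
theorem rotationJoining_of_withoutGibbs : RotationJoiningWithoutGibbs → RotationJoining :=
  fun h μ hμ hTI => h μ (IsGibbsMeasure.isProbabilityMeasure hμ) hTI

/-- LOAD-BEARING: any proof of `RotationJoining` must use the DLR/criticality hypothesis —
the translation-invariant layered i.i.d. measure `μL` has no power-rate (indeed no `o(1)`)
rotation joining. -/
theorem rotationJoining_false_without_gibbs : ¬ RotationJoiningWithoutGibbs :=
  fun h => not_RJBody_μL (h μL inferInstance isTranslationInvariant_μL)


/-! ## §7 Kozma's commensurate-rotation bijection `ψ = ⌊A·/3⌋` and the `β = 0` mutation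

`ψ : ℤ³ → ℤ³`, `ψ(x)_i = ⌊(Ax)_i / 3⌋`, is a BIJECTION (the lattice `Aℤ³` meets every aligned
3-cell in exactly one point) with `‖3ψ(x) − Ax‖_∞ ≤ 2`; every rotated cell of the crux is the
`ψ`-preimage of the corresponding axis cell, hence has exactly `n³` points. Consequence
(`rjBody_iid`): at `β = 0` (i.i.d. fair spins `μ₀`) the body of the crux holds with defect ZERO —
relabel copy 2 by `ψ` (`π = law of (σ, σ ∘ ψ⁻¹)`; i.i.d. is `ψ`-invariant). So replacing `β_c`
by `0` does not falsify the crux: the value of `β` is not load-bearing in the falsity direction;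
all the content of the crux is the power RATE in the interacting critical case. -/

/-- Kozma's device: `ψ(x) = ⌊Ax/3⌋` coordinatewise. -/
def psi (x : Site 3) : Site 3 := fun i => (Matrix.mulVec A x i) / 3

/-- Its inverse: `ψ⁻¹(w) = (Aᵀw + r(w)·(1,1,1))/3`, `r(w) = (w₀+w₁+w₂) mod 3`. -/
def psiInv (w : Site 3) : Site 3 :=
  ![(2 * w 0 - w 1 + 2 * w 2 + (w 0 + w 1 + w 2) % 3) / 3,
    (2 * w 0 + 2 * w 1 - w 2 + (w 0 + w 1 + w 2) % 3) / 3,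
    (-w 0 + 2 * w 1 + 2 * w 2 + (w 0 + w 1 + w 2) % 3) / 3]

@[simp] theorem psi_apply_zero (x : Site 3) : psi x 0 = (2 * x 0 + 2 * x 1 - x 2) / 3 := by
  simp [psi]
@[simp] theorem psi_apply_one (x : Site 3) : psi x 1 = (-x 0 + 2 * x 1 + 2 * x 2) / 3 := by
  simp [psi]
@[simp] theorem psi_apply_two (x : Site 3) : psi x 2 = (2 * x 0 - x 1 + 2 * x 2) / 3 := by
  simp [psi]
@[simp] theorem psiInv_apply_zero (w : Site 3) :
    psiInv w 0 = (2 * w 0 - w 1 + 2 * w 2 + (w 0 + w 1 + w 2) % 3) / 3 := rfl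
@[simp] theorem psiInv_apply_one (w : Site 3) :
    psiInv w 1 = (2 * w 0 + 2 * w 1 - w 2 + (w 0 + w 1 + w 2) % 3) / 3 := rfl
@[simp] theorem psiInv_apply_two (w : Site 3) :
    psiInv w 2 = (-w 0 + 2 * w 1 + 2 * w 2 + (w 0 + w 1 + w 2) % 3) / 3 := rfl

/-- `ψ ∘ ψ⁻¹ = id`. -/
theorem psi_psiInv (w : Site 3) : psi (psiInv w) = w := by
  ext i
  fin_cases i <;> simp <;> omega

/-- `ψ⁻¹ ∘ ψ = id`. -/
theorem psiInv_psi (x : Site 3) : psiInv (psi x) = x := by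
  ext i
  fin_cases i <;> simp <;> omega

/-- `ψ` as a permutation of `ℤ³`. -/
def psiEquiv : Site 3 ≃ Site 3 := ⟨psi, psiInv, psiInv_psi, psi_psiInv⟩

/-- `ψ` is within sup-distance `< 1` of the rotation `T = A/3`: `|3ψ(x)_i − (Ax)_i| ≤ 2`. -/
theorem abs_three_mul_psi_sub_le (x : Site 3) (i : Fin 3) :
    |3 * psi x i - Matrix.mulVec A x i| ≤ 2 := by
  rw [abs_le]
  fin_cases i <;> simp <;> omega

/-- Every rotated cell of the crux (block `u` inside the window `m`) is the `ψ⁻¹`-image of the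
corresponding axis cell; in particular it has exactly `n³` lattice points. -/
theorem rotCell_eq_map_psiInv {n m : ℕ} {u : Fin 3 → ℤ} (hu : ∀ i, |u i| ≤ m) :
    rotCell n m u = (axisCell n u).map psiEquiv.symm.toEmbedding := by
  ext x
  simp only [Finset.mem_map_equiv, Equiv.symm_symm, mem_rotCell_iff, mem_axisCell_iff, mem_box_iff]
  change _ ↔ ((n:ℤ) * u 0 ≤ psi x 0 ∧ psi x 0 < (n:ℤ) * u 0 + n) ∧ ((n:ℤ) * u 1 ≤ psi x 1 ∧ psi x 1 < (n:ℤ) * u 1 + n) ∧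
    ((n:ℤ) * u 2 ≤ psi x 2 ∧ psi x 2 < (n:ℤ) * u 2 + n)
  simp only [psi_apply_zero, psi_apply_one, psi_apply_two]
  have h0 := abs_le.1 (hu 0); have h1 := abs_le.1 (hu 1); have h2 := abs_le.1 (hu 2)
  have hn : (0:ℤ) ≤ n := by positivity
  have k0 : -((n:ℤ) * m) ≤ (n:ℤ) * u 0 ∧ (n:ℤ) * u 0 ≤ (n:ℤ) * m :=
    ⟨by nlinarith, mul_le_mul_of_nonneg_left h0.2 hn⟩
  have k1 : -((n:ℤ) * m) ≤ (n:ℤ) * u 1 ∧ (n:ℤ) * u 1 ≤ (n:ℤ) * m :=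
    ⟨by nlinarith, mul_le_mul_of_nonneg_left h1.2 hn⟩
  have k2 : -((n:ℤ) * m) ≤ (n:ℤ) * u 2 ∧ (n:ℤ) * u 2 ≤ (n:ℤ) * m :=
    ⟨by nlinarith, mul_le_mul_of_nonneg_left h2.2 hn⟩
  have hbox : 2 * (n:ℤ) * ((m:ℤ) + 1) = 2 * ((n:ℤ) * m) + 2 * n := by ring
  have e0 : 3 * (n:ℤ) * u 0 = 3 * ((n:ℤ) * u 0) := by ring
  have e1 : 3 * (n:ℤ) * u 1 = 3 * ((n:ℤ) * u 1) := by ring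
  have e2 : 3 * (n:ℤ) * u 2 = 3 * ((n:ℤ) * u 2) := by ring
  have f0 : 3 * (n:ℤ) * (u 0 + 1) = 3 * ((n:ℤ) * u 0) + 3 * n := by ring
  have f1 : 3 * (n:ℤ) * (u 1 + 1) = 3 * ((n:ℤ) * u 1) + 3 * n := by ring
  have f2 : 3 * (n:ℤ) * (u 2 + 1) = 3 * ((n:ℤ) * u 2) + 3 * n := by ring
  rw [hbox, e0, e1, e2, f0, f1, f2]
  generalize (n:ℤ) * u 0 = P0 at *
  generalize (n:ℤ) * u 1 = P1 at *
  generalize (n:ℤ) * u 2 = P2 at *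
  generalize (n:ℤ) * (m:ℤ) = Q at *
  constructor
  · rintro ⟨-, c0, c1, c2⟩; omega
  · rintro ⟨c0, c1, c2⟩; omega

/-- The reference rotated cell is the `ψ⁻¹`-image of the reference cube. -/
theorem rotCell₀_eq_map_psiInv (n m : ℕ) :
    rotCell₀ n m = (axisCell₀ n).map psiEquiv.symm.toEmbedding := by
  rw [← rotCell_zero, ← axisCell_zero]
  exact rotCell_eq_map_psiInv (fun i => by simp)

/-- Every rotated cell has exactly `n³` lattice points (SKELVET.md item 4, now proved). -/
theorem card_rotCell {n m : ℕ} {u : Fin 3 → ℤ} (hu : ∀ i, |u i| ≤ m) : (rotCell n m u).card = n ^ 3 := by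
  rw [rotCell_eq_map_psiInv hu, Finset.card_map, axisCell, Fintype.card_piFinset]
  simp [Finset.prod_const]

/-- The `β = 0` Gibbs measure of the model: i.i.d. fair spins on `ℤ³`. -/
def μ₀ : Measure (SpinConfig (Site 3)) := Measure.infinitePi (fun _ : Site 3 => coin)

instance μ₀_isProbabilityMeasure : IsProbabilityMeasure μ₀ := by unfold μ₀; infer_instance

/-- Relabelling by `ψ`: `(relabel σ)_w = σ_{ψ⁻¹ w}`. -/
def relabel (σ : SpinConfig (Site 3)) : SpinConfig (Site 3) := fun w => σ (psiEquiv.symm w)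

@[fun_prop]
theorem measurable_relabel : Measurable relabel :=
  measurable_pi_lambda _ (fun w => measurable_pi_apply (psiEquiv.symm w))

/-- Block sums over axis cells of the relabelled configuration are block sums over rotated cells. -/
theorem blockSum_axisCell_relabel {n m : ℕ} {u : Fin 3 → ℤ} (hu : ∀ i, |u i| ≤ m) (σ : SpinConfig (Site 3)) :
    blockSum (axisCell n u) (relabel σ) = blockSum (rotCell n m u) σ := by
  rw [rotCell_eq_map_psiInv hu]
  unfold blockSum
  rw [Finset.sum_map]
  rfl

theorem blockSum_axisCell₀_relabel (n m : ℕ) (σ : SpinConfig (Site 3)) :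
    blockSum (axisCell₀ n) (relabel σ) = blockSum (rotCell₀ n m) σ := by
  rw [rotCell₀_eq_map_psiInv]
  unfold blockSum
  rw [Finset.sum_map]
  rfl

/-- i.i.d. is `ψ`-invariant. -/
theorem map_relabel_μ₀ : μ₀.map relabel = μ₀ := by
  unfold μ₀ relabel
  exact map_reindex_infinitePi coin psiEquiv.symm

/-- The two self-normalisations agree at `β = 0`. -/
theorem normaliser_rotCell₀_μ₀ (n m : ℕ) : normaliser μ₀ (rotCell₀ n m) = normaliser μ₀ (axisCell₀ n) := by
  unfold normaliser
  congr 2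
  simp_rw [← blockSum_axisCell₀_relabel n m]
  have h := integral_map (μ := μ₀) measurable_relabel.aemeasurable
    (f := fun σ => blockSum (axisCell₀ n) σ ^ 2) (Measurable.aestronglyMeasurable (by fun_prop))
  rw [map_relabel_μ₀] at h
  exact h.symm

/-- MUTATION `β_c ↦ 0`: at infinite temperature the body of the crux holds with defect ZERO, for
every `n` and every window, via the deterministic relabelling coupling `π = law of (σ, σ ∘ ψ⁻¹)`. -/
theorem rjBody_iid : RJBody μ₀ := by
  refine ⟨0, 1, one_pos, fun n m _ => ?_⟩
  refine ⟨μ₀.map (fun σ => (σ, relabel σ)), ?_, ?_, fun u hu => ?_⟩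
  · rw [Measure.fst, Measure.map_map measurable_fst (by fun_prop)]
    exact Measure.map_id
  · rw [Measure.snd, Measure.map_map measurable_snd (by fun_prop)]
    exact map_relabel_μ₀
  · rw [zero_mul]
    unfold defect
    rw [integral_map (by fun_prop : Measurable fun σ : SpinConfig (Site 3) => (σ, relabel σ)).aemeasurable
      (Measurable.aestronglyMeasurable (by fun_prop))]
    simp only [blockSum_axisCell_relabel hu, normaliser_rotCell₀_μ₀, sub_self]
    simp


/-! ## §8 Towards the picked line (`SketchIdeator2`, card rate-from-dilations-splitting): its stub
`AsymptoticFDDIsotropy` (rate-free, coupling-free bounded-Lipschitz isotropy of finite block windows) is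
FALSE WITHOUT the Gibbs hypothesis — same witness `μL`, test function `f(v) = min(|v₀ − v₁|, 1)/2` on the
window `(0, e₀)`: `E_μL f(Y) = 0` (axis blocks coincide) while `E_μL f(X) ≥ 97/5000` at every `n = 3k`
(Khintchine fourth-moment bound for Rademacher sums + the truncation inequality
`min(|x|,1) ≥ τx² − τ²x⁴/4`). -/

/-- Khintchine-type fourth moment bound for Rademacher linear forms: `E[(Σ c_j ε_j)⁴] ≤ 3 (Σ c_j²)²`. -/
theorem integral_pow_four_linear_P_le (K : Finset ℤ) (c : ℤ → ℝ) :
    ∫ ε, (∑ j ∈ K, c j * spinAt j ε) ^ 4 ∂P ≤ 3 * (∑ j ∈ K, c j ^ 2) ^ 2 := by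
  classical
  induction K using Finset.induction_on with
  | empty => simp
  | @insert a K ha ih =>
    -- notation
    set S : (ℤ → ℤˣ) → ℝ := fun ε => ∑ j ∈ K, c j * spinAt j ε with hS
    have hSm : Measurable S := by rw [hS]; fun_prop
    have hSb : ∀ ε, |S ε| ≤ ∑ j ∈ K, |c j| := by
      intro ε
      rw [hS]
      refine (Finset.abs_sum_le_sum_abs _ _).trans (Finset.sum_le_sum fun j _ => ?_)
      rw [abs_mul, abs_spinAt, mul_one]
    have hdepS : DependsOn S (K : Set ℤ) := by
      intro x y hxy
      simp only [hS]
      refine Finset.sum_congr rfl fun j hj => ?_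
      simp only [spinAt, hxy j (by exact_mod_cast hj)]
    have hdepa : DependsOn (fun ε : ℤ → ℤˣ => spinAt a ε) (({a} : Finset ℤ) : Set ℤ) := by
      intro x y hxy; simp only [spinAt, hxy a (by simp)]
    have hdisj : Disjoint K {a} := Finset.disjoint_singleton_right.2 ha
    -- integrability of bounded measurable functions on the probability space `P`
    have hint : ∀ {g : (ℤ → ℤˣ) → ℝ}, Measurable g → ∀ B : ℝ, (∀ ε, |g ε| ≤ B) → Integrable g P :=
      fun hg B hB => Integrable.of_bound hg.aestronglyMeasurable B
        (ae_of_all _ (fun ε => by rw [Real.norm_eq_abs]; exact hB ε))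
    set B : ℝ := ∑ j ∈ K, |c j| with hB
    have hBnn : 0 ≤ B := Finset.sum_nonneg (fun j _ => abs_nonneg _)
    -- moments of the new coordinate against powers of S
    have hE2 : ∫ ε, S ε ^ 2 ∂P = ∑ j ∈ K, c j ^ 2 := by rw [hS]; exact integral_sq_linear_P K c
    have h31 : ∫ ε, S ε ^ 3 * spinAt a ε ∂P = 0 := by
      have := integral_mul_eq_of_dependsOn_disjoint (fun _ : ℤ => coin) hdisj
        (hSm.pow_const 3) (measurable_spinAt a)
        (fun x y hxy => by simp only [hdepS hxy]) hdepa
      unfold P at this ⊢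
      rw [this]
      change (∫ ε, S ε ^ 3 ∂P) * ∫ ε, spinAt a ε ∂P = 0
      rw [integral_spinAt_P, mul_zero]
    have h13 : ∫ ε, S ε * spinAt a ε ^ 3 ∂P = 0 := by
      have hcube : ∀ ε : ℤ → ℤˣ, spinAt a ε ^ 3 = spinAt a ε := fun ε => by
        rcases spinAt_eq_one_or_eq_neg_one a ε with h | h <;> rw [h] <;> norm_num
      simp_rw [hcube]
      have := integral_mul_eq_of_dependsOn_disjoint (fun _ : ℤ => coin) hdisj hSm (measurable_spinAt a)
        hdepS hdepa
      unfold P at this ⊢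
      rw [this]
      change (∫ ε, S ε ∂P) * ∫ ε, spinAt a ε ∂P = 0
      rw [integral_spinAt_P, mul_zero]
    have h22 : ∫ ε, S ε ^ 2 * spinAt a ε ^ 2 ∂P = ∑ j ∈ K, c j ^ 2 := by
      simp_rw [spinAt_sq, mul_one]; exact hE2
    have h04 : ∫ ε, spinAt a ε ^ 4 ∂(P) = 1 := by
      have : ∀ ε : ℤ → ℤˣ, spinAt a ε ^ 4 = 1 := fun ε => by
        rw [show (4:ℕ) = 2 * 2 from rfl, pow_mul, spinAt_sq, one_pow]
      simp [this]
    -- expand the fourth power of the sum over `insert a K`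
    have hexp : ∀ ε, (∑ j ∈ insert a K, c j * spinAt j ε) ^ 4 =
        S ε ^ 4 + 4 * c a * (S ε ^ 3 * spinAt a ε) + 6 * c a ^ 2 * (S ε ^ 2 * spinAt a ε ^ 2) +
          4 * c a ^ 3 * (S ε * spinAt a ε ^ 3) + c a ^ 4 * spinAt a ε ^ 4 := by
      intro ε
      rw [Finset.sum_insert ha, hS]
      ring
    simp_rw [hexp]
    have iS4 : Integrable (fun ε => S ε ^ 4) P :=
      hint (hSm.pow_const 4) (B ^ 4) (fun ε => by rw [abs_pow]; exact pow_le_pow_left₀ (abs_nonneg _) (hSb ε) 4)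
    have iS3a : Integrable (fun ε => S ε ^ 3 * spinAt a ε) P :=
      hint ((hSm.pow_const 3).mul (measurable_spinAt a)) (B ^ 3) (fun ε => by
        rw [abs_mul, abs_spinAt, mul_one, abs_pow]; exact pow_le_pow_left₀ (abs_nonneg _) (hSb ε) 3)
    have iS2a : Integrable (fun ε => S ε ^ 2 * spinAt a ε ^ 2) P :=
      hint ((hSm.pow_const 2).mul ((measurable_spinAt a).pow_const 2)) (B ^ 2) (fun ε => by
        rw [spinAt_sq, mul_one, abs_pow]; exact pow_le_pow_left₀ (abs_nonneg _) (hSb ε) 2)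
    have iS1a : Integrable (fun ε => S ε * spinAt a ε ^ 3) P :=
      hint (hSm.mul ((measurable_spinAt a).pow_const 3)) B (fun ε => by
        rw [abs_mul, abs_pow, abs_spinAt, one_pow, mul_one]; exact hSb ε)
    have ia4 : Integrable (fun ε => spinAt a ε ^ 4) P :=
      hint ((measurable_spinAt a).pow_const 4) 1 (fun ε => by rw [abs_pow, abs_spinAt, one_pow])
    rw [integral_add, integral_add, integral_add, integral_add, integral_const_mul, integral_const_mul,
      integral_const_mul, integral_const_mul, h31, h13, h22, h04, Finset.sum_insert ha]
    · have hca : 0 ≤ c a ^ 4 := by positivity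
      nlinarith [ih, Finset.sum_nonneg (fun j (_ : j ∈ K) => sq_nonneg (c j)), sq_nonneg (c a)]
    all_goals first
      | exact iS4
      | exact (iS3a.const_mul _)
      | exact (iS2a.const_mul _)
      | exact (iS1a.const_mul _)
      | exact (ia4.const_mul _)
      | exact iS4.add (iS3a.const_mul _)
      | exact (iS4.add (iS3a.const_mul _)).add (iS2a.const_mul _)
      | exact ((iS4.add (iS3a.const_mul _)).add (iS2a.const_mul _)).add (iS1a.const_mul _)

/-- Truncation inequality: for `τ ≤ 1`, `min(|x|, 1) ≥ τ x² − τ² x⁴ / 4`. -/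
theorem min_abs_one_ge (x τ : ℝ) (h1 : τ ≤ 1) :
    τ * x ^ 2 - τ ^ 2 * x ^ 4 / 4 ≤ min |x| 1 := by
  have hle1 : τ * x ^ 2 - τ ^ 2 * x ^ 4 / 4 ≤ 1 := by nlinarith [sq_nonneg (τ * x ^ 2 - 2)]
  refine le_min ?_ hle1
  rcases le_total |x| 1 with hx | hx
  · have hx2 : x ^ 2 ≤ |x| := by
      have : x ^ 2 = |x| * |x| := by rw [← sq, sq_abs]
      rw [this]; exact mul_le_of_le_one_right (abs_nonneg x) hx
    have : τ ^ 2 * x ^ 4 / 4 ≥ 0 := by positivity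
    nlinarith [mul_le_mul h1 hx2 (sq_nonneg x) zero_le_one]
  · exact hle1.trans hx


/-- The normalised difference of the two rotated block readings of ONE copy, through the layering. -/
def Dk (k : ℕ) (ε : ℤ → ℤˣ) : ℝ :=
  normaliser μL (rotCell₀ (3 * k) 1) *
    (blockSum (rotCell₀ (3 * k) 1) (layer ε) - blockSum (rotCell (3 * k) 1 e0) (layer ε))

theorem Dk_eq_linear (k : ℕ) (ε : ℤ → ℤˣ) :
    Dk k ε = normaliser μL (rotCell₀ (3 * k) 1) *
      ∑ j ∈ Kwin k, (profile (rotCell₀ (3 * k) 1) j - profile (rotCell₀ (3 * k) 1) (j + k)) * spinAt j ε := by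
  unfold Dk
  rw [blockSum_rotCell₀_layer, blockSum_rotCell_e0_layer, ← Finset.sum_sub_distrib]
  congr 1
  refine Finset.sum_congr rfl fun j _ => ?_
  ring

@[fun_prop]
theorem measurable_Dk (k : ℕ) : Measurable (Dk k) := by
  unfold Dk; fun_prop

theorem abs_Dk_le (k : ℕ) (ε : ℤ → ℤˣ) :
    |Dk k ε| ≤ |normaliser μL (rotCell₀ (3 * k) 1)| *
      ((rotCell₀ (3 * k) 1).card + (rotCell (3 * k) 1 e0).card) := by
  unfold Dk
  rw [abs_mul]
  refine mul_le_mul_of_nonneg_left ((abs_sub _ _).trans (add_le_add (abs_blockSum_le _ _)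
    (abs_blockSum_le _ _))) (abs_nonneg _)

/-- `E[D²] = V₁/V₀`. -/
theorem integral_Dk_sq (k : ℕ) : ∫ ε, Dk k ε ^ 2 ∂P = (V0 k)⁻¹ * V1 k := by
  unfold Dk
  simp_rw [mul_pow]
  rw [integral_const_mul, integral_sq_blockSum_sub, normaliser_rotCell₀_sq]

/-- `E[D⁴] ≤ 3 (V₁/V₀)²` (Khintchine). -/
theorem integral_Dk_pow_four_le (k : ℕ) : ∫ ε, Dk k ε ^ 4 ∂P ≤ 3 * ((V0 k)⁻¹ * V1 k) ^ 2 := by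
  simp_rw [Dk_eq_linear, mul_pow]
  rw [integral_const_mul]
  have h4 : normaliser μL (rotCell₀ (3 * k) 1) ^ 4 = ((V0 k)⁻¹) ^ 2 := by
    rw [show (4:ℕ) = 2 * 2 from rfl, pow_mul, normaliser_rotCell₀_sq]
  rw [h4]
  have hK := integral_pow_four_linear_P_le (Kwin k)
    (fun j => profile (rotCell₀ (3 * k) 1) j - profile (rotCell₀ (3 * k) 1) (j + k))
  have hV1 : ∑ j ∈ Kwin k, (profile (rotCell₀ (3 * k) 1) j - profile (rotCell₀ (3 * k) 1) (j + k)) ^ 2 = V1 k := rfl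
  rw [hV1] at hK
  have hnn : 0 ≤ ((V0 k)⁻¹) ^ 2 := sq_nonneg _
  calc ((V0 k)⁻¹) ^ 2 * ∫ ε, (∑ j ∈ Kwin k, (profile (rotCell₀ (3 * k) 1) j -
        profile (rotCell₀ (3 * k) 1) (j + ↑k)) * spinAt j ε) ^ 4 ∂P
      ≤ ((V0 k)⁻¹) ^ 2 * (3 * (V1 k) ^ 2) := mul_le_mul_of_nonneg_left hK hnn
    _ = 3 * ((V0 k)⁻¹ ^ 2 * V1 k ^ 2) := by ring

/-- KEY ESTIMATE (bounded-Lipschitz form): `E min(|D|, 1) ≥ 97/2500` at every `n = 3k`, `k ≥ 1`. -/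
theorem integral_min_abs_Dk_ge {k : ℕ} (hk : 1 ≤ k) : (97:ℝ) / 2500 ≤ ∫ ε, min |Dk k ε| 1 ∂P := by
  set s2 : ℝ := (V0 k)⁻¹ * V1 k with hs2
  have hV0 : 1 ≤ V0 k := one_le_V0 hk
  have hV0pos : 0 < V0 k := by linarith
  have hV1 : V0 k ≤ 25 * V1 k := V0_le k
  have hs2lo : (1:ℝ) / 25 ≤ s2 := by
    rw [hs2, inv_mul_eq_div, le_div_iff₀ hV0pos]; linarith
  have hs2pos : 0 < s2 := by linarith
  set τ : ℝ := 1 / (25 * s2) with hτ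
  have hτ1 : τ ≤ 1 := by
    rw [hτ, div_le_one (by positivity)]; linarith
  -- integrability
  set B : ℝ := |normaliser μL (rotCell₀ (3 * k) 1)| *
      ((rotCell₀ (3 * k) 1).card + (rotCell (3 * k) 1 e0).card) with hB
  have hDb : ∀ ε, |Dk k ε| ≤ B := abs_Dk_le k
  have hint : ∀ {g : (ℤ → ℤˣ) → ℝ}, Measurable g → ∀ C : ℝ, (∀ ε, |g ε| ≤ C) → Integrable g P :=
    fun hg C hC => Integrable.of_bound hg.aestronglyMeasurable C
      (ae_of_all _ (fun ε => by rw [Real.norm_eq_abs]; exact hC ε))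
  have i2 : Integrable (fun ε => Dk k ε ^ 2) P :=
    hint ((measurable_Dk k).pow_const 2) (B ^ 2) (fun ε => by
      rw [abs_pow]; exact pow_le_pow_left₀ (abs_nonneg _) (hDb ε) 2)
  have i4 : Integrable (fun ε => Dk k ε ^ 4) P :=
    hint ((measurable_Dk k).pow_const 4) (B ^ 4) (fun ε => by
      rw [abs_pow]; exact pow_le_pow_left₀ (abs_nonneg _) (hDb ε) 4)
  have imin : Integrable (fun ε => min |Dk k ε| 1) P :=
    hint ((measurable_Dk k).abs.min measurable_const) 1 (fun ε => by
      rw [abs_le]; constructor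
      · linarith [le_min (abs_nonneg (Dk k ε)) zero_le_one]
      · exact min_le_right _ _)
  -- pointwise truncation, integrated
  have hpt : ∀ ε, τ * Dk k ε ^ 2 - τ ^ 2 * Dk k ε ^ 4 / 4 ≤ min |Dk k ε| 1 :=
    fun ε => min_abs_one_ge (Dk k ε) τ hτ1
  have hle : ∫ ε, (τ * Dk k ε ^ 2 - τ ^ 2 * Dk k ε ^ 4 / 4) ∂P ≤ ∫ ε, min |Dk k ε| 1 ∂P :=
    integral_mono ((i2.const_mul τ).sub ((i4.const_mul (τ ^ 2)).div_const 4)) imin hpt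
  have heq : ∫ ε, (τ * Dk k ε ^ 2 - τ ^ 2 * Dk k ε ^ 4 / 4) ∂P =
      τ * ∫ ε, Dk k ε ^ 2 ∂P - τ ^ 2 * (∫ ε, Dk k ε ^ 4 ∂P) / 4 := by
    rw [integral_sub (i2.const_mul τ) ((i4.const_mul (τ ^ 2)).div_const 4), integral_const_mul,
      integral_div, integral_const_mul]
  rw [heq, integral_Dk_sq] at hle
  have h4 := integral_Dk_pow_four_le k
  rw [← hs2] at hle h4
  -- τ s2 - τ² m4 /4 ≥ τ s2 - τ² (3 s2²)/4 = 97/2500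
  have hτs : τ * s2 = 1 / 25 := by
    rw [hτ]; field_simp
  have hτnn : 0 ≤ τ ^ 2 := sq_nonneg _
  have step : τ * s2 - τ ^ 2 * (3 * s2 ^ 2) / 4 ≤ τ * s2 - τ ^ 2 * (∫ ε, Dk k ε ^ 4 ∂P) / 4 := by
    nlinarith [mul_le_mul_of_nonneg_left h4 hτnn]
  have val : τ * s2 - τ ^ 2 * (3 * s2 ^ 2) / 4 = 97 / 2500 := by
    have : τ ^ 2 * s2 ^ 2 = (τ * s2) ^ 2 := by ring
    rw [show τ ^ 2 * (3 * s2 ^ 2) / 4 = 3 * (τ ^ 2 * s2 ^ 2) / 4 by ring, this, hτs]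
    norm_num
  linarith

/-- The bounded `1`-Lipschitz test function `f(v) = min(|v₀ − v₁|, 1)/2` on a window of two blocks. -/
def ftest (v : Fin 2 → ℝ) : ℝ := min |v 0 - v 1| 1 / 2

theorem ftest_lipschitz : LipschitzWith 1 ftest := by
  refine LipschitzWith.of_le_add fun a b => ?_
  simp only [ftest]
  have h0 : |a 0 - b 0| ≤ dist a b := by rw [← Real.dist_eq]; exact dist_le_pi_dist a b 0
  have h1 : |a 1 - b 1| ≤ dist a b := by rw [← Real.dist_eq]; exact dist_le_pi_dist a b 1
  have hmin : min |a 0 - a 1| 1 ≤ min |b 0 - b 1| 1 + (|a 0 - b 0| + |a 1 - b 1|) := by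
    have htri : |a 0 - a 1| ≤ |b 0 - b 1| + (|a 0 - b 0| + |a 1 - b 1|) := by
      have := abs_sub_le (a 0) (b 0) (a 1)
      have := abs_sub_le (b 0) (b 1) (a 1)
      have := abs_sub_comm (b 1) (a 1)
      linarith
    rcases le_total |b 0 - b 1| 1 with hb | hb
    · rw [min_eq_left hb]
      exact (min_le_left _ _).trans htri
    · rw [min_eq_right hb]
      linarith [min_le_right |a 0 - a 1| 1, abs_nonneg (a 0 - b 0), abs_nonneg (a 1 - b 1)]
  linarith

theorem ftest_continuous : Continuous ftest := ftest_lipschitz.continuous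

theorem abs_ftest_le (v : Fin 2 → ℝ) : |ftest v| ≤ 1 / 2 := by
  unfold ftest
  rw [abs_le]
  constructor
  · linarith [le_min (abs_nonneg (v 0 - v 1)) zero_le_one]
  · linarith [min_le_right |v 0 - v 1| 1]

/-- LOAD-BEARING for the picked line's stub `AsymptoticFDDIsotropy` (rate-free bounded-Lipschitz isotropy of
finite block windows, here in this file's vocabulary `normaliser/rotCell/axisCell` — the line's `normTilt μ n m`
is `normaliser μ (rotCell n m 0)` and `tiltCell = rotCell`, `rotCell n m 0 = rotCell₀ n m` by `rotCell_zero`):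
with the Gibbs hypothesis weakened to "translation-invariant probability measure" it is FALSE. Witness `μL`,
window `(0, e₀)`, test `ftest`: the axis reading gives `0`, the rotated reading `≥ 97/5000` at every `n = 3k`. -/
theorem asymptoticFDDIsotropy_false_without_gibbs :
    ¬ ∀ μ : Measure (SpinConfig (Site 3)), IsProbabilityMeasure μ → IsTranslationInvariantMeasure μ →
      ∀ (j m : ℕ) (us : Fin j → (Fin 3 → ℤ)), (∀ i l, |us i l| ≤ m) →
        ∀ f : (Fin j → ℝ) → ℝ, LipschitzWith 1 f → (∃ B : ℝ, ∀ v, |f v| ≤ B) →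
          Tendsto (fun n : ℕ =>
            (∫ σ, f (fun i => normaliser μ (rotCell₀ n m) * blockSum (rotCell n m (us i)) σ) ∂μ) -
              ∫ σ, f (fun i => normaliser μ (axisCell₀ n) * blockSum (axisCell n (us i)) σ) ∂μ)
            atTop (nhds 0) := by
  intro h
  have hus : ∀ i l, |(![0, e0] : Fin 2 → (Fin 3 → ℤ)) i l| ≤ ((1:ℕ):ℤ) := by
    intro i l
    fin_cases i
    · simp
    · simpa using abs_e0_le l
  have H := h μL inferInstance isTranslationInvariant_μL 2 1 ![0, e0] hus ftest ftest_lipschitz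
    ⟨1 / 2, abs_ftest_le⟩
  -- the axis reading vanishes identically
  have haxis : ∀ n : ℕ, ∫ σ, ftest (fun i => normaliser μL (axisCell₀ n) *
      blockSum (axisCell n ((![0, e0] : Fin 2 → (Fin 3 → ℤ)) i)) σ) ∂μL = 0 := by
    intro n
    have hmeas : Measurable (fun σ : SpinConfig (Site 3) => ftest (fun i => normaliser μL (axisCell₀ n) *
        blockSum (axisCell n ((![0, e0] : Fin 2 → (Fin 3 → ℤ)) i)) σ)) :=
      ftest_continuous.measurable.comp (measurable_pi_lambda _ (fun i => by fun_prop))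
    rw [integral_μL hmeas]
    have : ∀ ε, ftest (fun i => normaliser μL (axisCell₀ n) *
        blockSum (axisCell n ((![0, e0] : Fin 2 → (Fin 3 → ℤ)) i)) (layer ε)) = 0 := by
      intro ε
      simp [ftest, blockSum_axisCell_e0_layer, axisCell_zero]
    simp [this]
  -- the rotated reading at n = 3k is E min(|D|,1)/2 ≥ 97/5000
  have hrot : ∀ k : ℕ, 1 ≤ k → (97:ℝ) / 5000 ≤ ∫ σ, ftest (fun i => normaliser μL (rotCell₀ (3 * k) 1) *
      blockSum (rotCell (3 * k) 1 ((![0, e0] : Fin 2 → (Fin 3 → ℤ)) i)) σ) ∂μL := by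
    intro k hk
    have hmeas : Measurable (fun σ : SpinConfig (Site 3) => ftest (fun i =>
        normaliser μL (rotCell₀ (3 * k) 1) *
          blockSum (rotCell (3 * k) 1 ((![0, e0] : Fin 2 → (Fin 3 → ℤ)) i)) σ)) :=
      ftest_continuous.measurable.comp (measurable_pi_lambda _ (fun i => by fun_prop))
    rw [integral_μL hmeas]
    have : ∀ ε, ftest (fun i => normaliser μL (rotCell₀ (3 * k) 1) *
        blockSum (rotCell (3 * k) 1 ((![0, e0] : Fin 2 → (Fin 3 → ℤ)) i)) (layer ε)) =
        min |Dk k ε| 1 / 2 := by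
      intro ε
      simp only [ftest, Dk, Matrix.cons_val_zero, Matrix.cons_val_one, rotCell_zero, mul_sub]
    simp_rw [this]
    rw [integral_div]
    have := integral_min_abs_Dk_ge hk
    linarith
  -- along n = 3k the sequence stays ≥ 97/5000, contradicting the limit 0
  have h3' : Tendsto (fun k : ℕ => 3 * k) atTop atTop :=
    tendsto_atTop_atTop.2 (fun b => ⟨b, fun a ha => by omega⟩)
  have H3 := H.comp h3'
  have hev : ∀ᶠ k : ℕ in atTop, ((fun n : ℕ =>
      (∫ σ, ftest (fun i => normaliser μL (rotCell₀ n 1) *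
          blockSum (rotCell n 1 ((![0, e0] : Fin 2 → (Fin 3 → ℤ)) i)) σ) ∂μL) -
        ∫ σ, ftest (fun i => normaliser μL (axisCell₀ n) *
          blockSum (axisCell n ((![0, e0] : Fin 2 → (Fin 3 → ℤ)) i)) σ) ∂μL) ∘ fun k : ℕ => 3 * k) k ∈
      Set.Iio ((97:ℝ) / 5000) :=
    H3.eventually_mem (Iio_mem_nhds (by norm_num))
  obtain ⟨k, hk1, hk2⟩ := (hev.and (eventually_ge_atTop 1)).exists
  simp only [Function.comp_apply, Set.mem_Iio, haxis, sub_zero] at hk1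
  exact absurd (hrot k hk2) (not_le.2 hk1)


/-! ## §9 The picked line's vocabulary (`RateSplitting`, `Theorems/SynchronousCouplingDefs.lean`) and the
QUALITATIVE joining: `tiltCell / axisCell / blockSum / normTilt / normAxis` are the same terms as this file's
`rotCell / axisCell / blockSum / normaliser`, so the line's per-block `L²` defect is `defect μ n m u π`; and the
line's `QualitativeRotationJoining` (the crux with `C n^(−θ)` replaced by any `ε > 0` beyond a window-uniform
`N(ε)`) is FALSE without the Gibbs hypothesis (`ε = 1/151`, blocks `0, e₀`, scales `n = 3k`). Since the rate
version implies the qualitative one measure by measure, this sharpens §6. (Landed as module 7,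
`Negative/LineFormWithoutGibbs.lean`; reshape-2 stub analysis in the findings block.) -/

/-- The line's tilted cell is this file's rotated cell (same term). -/
theorem tiltCell_eq_rotCell (n m : ℕ) (u : Fin 3 → ℤ) : RateSplitting.tiltCell n m u = rotCell n m u := rfl

/-- The line's axis cell is this file's axis cell (same term). -/
theorem lineAxisCell_eq (n : ℕ) (u : Fin 3 → ℤ) : RateSplitting.axisCell n u = axisCell n u := rfl

/-- The line's block sum is this file's block sum (same term). -/
theorem lineBlockSum_eq (S : Finset (Site 3)) (σ : SpinConfig (Site 3)) :
    RateSplitting.blockSum S σ = blockSum S σ := rfl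

/-- The line's tilted normaliser is `normaliser μ (rotCell₀ n m)`. -/
theorem normTilt_eq (μ : Measure (SpinConfig (Site 3))) (n m : ℕ) :
    RateSplitting.normTilt μ n m = normaliser μ (rotCell₀ n m) := by
  rw [← rotCell_zero]; rfl

/-- The line's axis normaliser is `normaliser μ (axisCell₀ n)`. -/
theorem normAxis_eq (μ : Measure (SpinConfig (Site 3))) (n : ℕ) :
    RateSplitting.normAxis μ n = normaliser μ (axisCell₀ n) := by
  rw [← axisCell_zero]; rfl

/-- The line's per-block `L²` defect under a coupling `π` is `defect μ n m u π`. -/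
theorem lineDefect_eq (μ : Measure (SpinConfig (Site 3))) (n m : ℕ) (u : Fin 3 → ℤ)
    (π : Measure (SpinConfig (Site 3) × SpinConfig (Site 3))) :
    ∫ q, (RateSplitting.normTilt μ n m * RateSplitting.blockSum (RateSplitting.tiltCell n m u) q.1 -
        RateSplitting.normAxis μ n * RateSplitting.blockSum (RateSplitting.axisCell n u) q.2) ^ 2 ∂π =
      defect μ n m u π := by
  simp only [normTilt_eq, normAxis_eq, tiltCell_eq_rotCell, lineAxisCell_eq, lineBlockSum_eq]
  rfl

/-- READ-BACK: the line's `QualitativeRotationJoining` is the `ε`-version of the crux over `defect`. -/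
theorem qualitativeRotationJoining_iff_defect :
    RateSplitting.QualitativeRotationJoining ↔
      ∀ μ ∈ isingGibbsMeasures 3 (criticalBeta 3) 0, IsTranslationInvariantMeasure μ →
        ∀ ε : ℝ, 0 < ε → ∃ N : ℕ, ∀ n m : ℕ, N ≤ n →
          ∃ π : Measure (SpinConfig (Site 3) × SpinConfig (Site 3)), π.fst = μ ∧ π.snd = μ ∧
            ∀ u : Fin 3 → ℤ, (∀ i, |u i| ≤ m) → defect μ n m u π ≤ ε := by
  unfold RateSplitting.QualitativeRotationJoining
  simp only [lineDefect_eq]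

/-- The line's `QualitativeRotationJoining` with the Gibbs membership weakened to "probability measure". -/
def QualitativeRotationJoiningWithoutGibbs : Prop :=
  ∀ μ : Measure (SpinConfig (Site 3)), IsProbabilityMeasure μ → IsTranslationInvariantMeasure μ →
    ∀ ε : ℝ, 0 < ε → ∃ N : ℕ, ∀ n m : ℕ, N ≤ n →
      ∃ π : Measure (SpinConfig (Site 3) × SpinConfig (Site 3)), π.fst = μ ∧ π.snd = μ ∧
        ∀ u : Fin 3 → ℤ, (∀ i, |u i| ≤ m) →
          ∫ q, (RateSplitting.normTilt μ n m * RateSplitting.blockSum (RateSplitting.tiltCell n m u) q.1 -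
              RateSplitting.normAxis μ n * RateSplitting.blockSum (RateSplitting.axisCell n u) q.2) ^ 2 ∂π ≤ ε

/-- **Load-bearing hypothesis, qualitative form.** `QualitativeRotationJoiningWithoutGibbs` is false: witness
`μL`, `ε = 1/151`, blocks `u = 0, e₀` of window `1` at the scales `n = 3k` (`defect_pair_lower_bound`). -/
theorem qualitativeRotationJoining_false_without_gibbs : ¬ QualitativeRotationJoiningWithoutGibbs := by
  intro h
  obtain ⟨N, hN⟩ := h μL inferInstance isTranslationInvariant_μL (1 / 151) (by norm_num)
  obtain ⟨π, hfst, hsnd, Hu⟩ := hN (3 * (N + 1)) 1 (by omega)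
  have h0 := Hu 0 (fun i => by simp)
  have h1 := Hu e0 abs_e0_le
  rw [lineDefect_eq] at h0 h1
  have key := defect_pair_lower_bound (k := N + 1) (by omega) π hfst hsnd h0 h1
  norm_num at key

/-- READ-BACK: the line's `AsymptoticFDDIsotropy` over this file's cells and normalisers — word for word the
body refuted without Gibbs in §8, with `IsProbabilityMeasure μ` strengthened back to `μ ∈ 𝒢(β_c)`. -/
theorem asymptoticFDDIsotropy_iff_lane :
    RateSplitting.AsymptoticFDDIsotropy ↔
      ∀ μ ∈ isingGibbsMeasures 3 (criticalBeta 3) 0, IsTranslationInvariantMeasure μ →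
        ∀ (j m : ℕ) (us : Fin j → (Fin 3 → ℤ)), (∀ i l, |us i l| ≤ m) →
          ∀ f : (Fin j → ℝ) → ℝ, LipschitzWith 1 f → (∃ B : ℝ, ∀ v, |f v| ≤ B) →
            Tendsto (fun n : ℕ =>
              (∫ σ, f (fun i => normaliser μ (rotCell₀ n m) * blockSum (rotCell n m (us i)) σ) ∂μ) -
                ∫ σ, f (fun i => normaliser μ (axisCell₀ n) * blockSum (axisCell n (us i)) σ) ∂μ)
              atTop (nhds 0) := by
  unfold RateSplitting.AsymptoticFDDIsotropy
  simp only [normTilt_eq, normAxis_eq, tiltCell_eq_rotCell, lineAxisCell_eq, lineBlockSum_eq]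

end

end Summit.CriticalPhenomena.Ising3DConformalLimit.Cruxes.RotationJoining.Disproof
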